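import Literature.MathematicalPhysics.QuantumFieldTheory.Balaban1983to89.B1Eq324BenfattoClassSectEMemberPrecisionDoorOnLambda
import Literature.MathematicalPhysics.QuantumFieldTheory.Balaban1983to89.B1Eq324BenfattoClassSectEMemberJRowScaleAtNode00
import Literature.MathematicalPhysics.QuantumFieldTheory.Balaban1983to89.Node00.OpsYSectEPrintUnits
import Literature.MathematicalPhysics.QuantumFieldTheory.Balaban1983to89.B8Ineq130
import Literature.MathematicalPhysics.QuantumFieldTheory.Balaban1983to89.B1Eq324BenfattoClassSectEMemberPRowDictionaryAtNode00
import Literature.MathematicalPhysics.QuantumFieldTheory.Balaban1983to89.B9Eq3132NuReadingAtOne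
import Literature.MathematicalPhysics.QuantumFieldTheory.Balaban1983to89.B1Eq324BenfattoClassSectEMemberJRowCompositionAtNode00
import Literature.MathematicalPhysics.QuantumFieldTheory.Balaban1983to89.B9BackgroundsKLevelV1R

/-!
# `Balaban1983to89.B1Eq324BenfattoClassSectEMemberPrecisionDoorRowsByName` — THE CITABLE (3.24) PRECISION DOOR FOR `dμ_{C̃^{(k)}(Λ; U)}` WITH ITS ROWS
# BY NAME: def-Y's named print-unit letter `CsDeltaCPY = η^{d+1}•C*Δ_kC`; the P-row (R2′a)|_Λ as node N06's numbered row 26 `B9.Ineq3132 …` per background and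
# as the family statement `B9.Stmt3132Printed …`; the 𝒥-row (R2′b)|_Λ as seat n08-d's composition modulo three primitive rows; and the `U = 1` editions, in which
# every NODE-00 row, [5]'s reality, the 𝒥-row AND the P-row are theorems — (3.24) at the trivial background modulo `γ₀` alone
# (seat dag-n08-b gen 34, CLAIM-11; node N08 [Balaban1985UV3], row `h324c`)

statement-level companion of published sources with citation tags; every declaration here is a theorem; nothing here is a claim about the
Yang–Mills mass gap

THE PRINTED LOCUS.  [Balaban1985BackgroundPropagators] (= [B9]) Sect. E p. 428, (3.156)–(3.158): *"⟨B,(QG₁Q\*)⁻¹B⟩ − a⟨B,B⟩ − 2⟨H₁D̃⁽²⁾(B),J⟩ = ⟨B,Δ_kB⟩ …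
B = CB̃ … C̃^{(k)}(Λ) = (C\*Δ_kC)⁻¹"*, pairings `⟨A,A′⟩ = η^{d+1}Σ_b …` of (3.13) p. 392 (def-Y's convention word (v): NODE 00's flat precision-type letters are
print's `× η^{−(d+1)}`, named once as `etaDY ∕ deltaKPY ∕ CsDeltaCPY` in `Node00.OpsYSectEPrintUnits`); p. 419 after (3.117): *"the function J = D\*η⁻²Im ∂U is
small, if U satisfies the condition (3.36)"* — and `J(1) = 0`; [Balaban1985RegularSpaces] p. 98: *"identically equal to 1 satisfies, of course, all possible
regularity conditions"*.  [Balaban1985UV3] (24) p. 262 and pp. 271–272: the cumulant remainder of the Gaussian integration determined by `⟨A, C\*Δ_kCA⟩` (row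
`h324c` of node N08).  [Balaban1982Higgs1] (3.24) p. 616; [BenfattoEtAl1978] Lemma (4.5)–(4.7) p. 152 (class form).

WHY THIS MODULE (cell `pub-ymgap`, seat `dag-n08-b` gen 34, CLAIM-11).  The citable door p676397 §3
`eq324_CsDeltaCY_precision_opsYOfRecordV8E_trBasis_of_plaqSmall_onΛ_on_unit` carries print's scale `η^{d+1}` as an inline token and DISPLAYS, next to the
regime (`G ≤ U(N)`, `G`-valued `U`, plaquette smallness) and [5]'s reality of `C⁽²⁾(U)`, `D̃⁽²⁾(U)`, three rows of node N06 ∕ NODE 00 vocabulary: (R2′a)|_Λ the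
(3.132) reading of `η^{d+1}(QG₁Q\*)⁻¹(U)` on Λ-bonds, (R2′b)|_Λ a reading of `η^{d+1}(a + ⟨D̃⁽²⁾·,J⟩(U))` on Λ-bonds, (R5′) `γ₀`.  Since then def-Y NAMED the
print-unit currency (`Node00.OpsYSectEPrintUnits`: `etaDY x` is literally the inline token, `CsDeltaCPY x 𝔏 𝔢 U := (etaDY x : ℂ) • CsDeltaCY x 𝔏 𝔢 U`) and
seat n08-d PROVED the print-unit 𝒥-row at `U = 1` for every member (`…JRowScaleAtNode00.JRowPrint_one_record`, `K_J := θ.b₁`).  THIS FILE (i) re-keys the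
door to def-Y's names (§1: conclusion (3.24) for `𝒩(0, 𝕄_ι(CsDeltaCPY U)⁻¹)`, definitionally p676397 §3 — so every later consumer cites ONE letter), and
(ii) lands the `U = 1` EDITION (§2): at the trivial background the regime rows, [5]'s reality rows and the 𝒥-row are THEOREMS — `1 ∈ G` for every `G`
(internally `G := ⊥`), `avYOfRecord x 1 = 1` so plaquette smallness holds with `a := 0` and the small-curvature numeral is `L^{d+1}·0 < 1`, `Δ⁽²⁾(1) = 0` and
`⟨D̃⁽²⁾·,J⟩(1) = 0` (the letters' `U = 1` clauses, theorems of def-Y's `delta2OfY ∕ d2JOfY` since `J(1) = 0`) give (R1′) with no reality hypothesis, and n08-d's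
`JRowPrint_one_record` gives (R2′b)|_Λ — leaving DISPLAYED only node N06's P-row (R2′a)|_Λ at `U = 1` and `γ₀` (R5′) at `U = 1`: a non-vacuity certificate
of the door's NODE-00 ∕ 𝒥 side, uniformly in `k`.  (iii) THE P-ROW BY NAME (§3): seat n08-d's top-level geometry dictionary
(`…PRowDictionaryAtNode00.pRowOnΛ_opsYNuOfRecordV4E_of_ineq3132`: on Λ-bonds `ν(u)ν(v) = η^{d+1}`, `Lʲη = 1`, `|y − y′| ≤ d(y,y′)`) turns node N06's NUMBERED
row 26 at a background — `B9.Ineq3132 (d+1) ((opsYNuOfRecordV4E N θ M⋆ (resYOfC2 𝔠) 𝔢 𝔴 𝔈 x).QG1Qinv) B_P δ U`, the conjunct n06-i's `s3132Nu_opsYNuOfRecordV4E`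
concludes — into the displayed (R2′a)|_Λ, so the per-background door now carries N06's row BY NAME; and at `U = 1` that row is n06-i's THEOREM
(`B9Eq3132NuReadingAtOne.ineq3132Nu_one`: [B9] Cor. 3.5 «for U = 1 these theorems are proved in [4]», [4] Prop. 2.7 (2.149) with its coercivity unconditional
in the tree), so the `U = 1` door holds for every member above a threshold `M₆` MODULO `γ₀` ALONE (§3, second theorem).  (iv) THE 𝒥-ROW BY NAME (§4): seat n08-d's
composition `…JRowCompositionAtNode00.JRowPrint_sectEYWithDt2_onΛ` (OFFER-87: `K_J := θ.b₁ + 2N³·j·M_H·C₂·e^{δr₂}` from a print-unit column mass `M_H` of `H₁(U)`,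
locality radius `r₂` and size `C₂` of [5]'s letter `D̃⁽²⁾(U)`, and `‖J(U)(b)‖ ≤ j`) replaces the displayed (R2′b)|_Λ at the P-row's rate, so the per-background door
reads N06's row 26 + three primitive rows + `γ₀`; and the FAMILY FORM takes the conclusion type of n06-i's `s3132Nu_opsYNuOfRecordV4E` (`B9.Stmt3132Printed …`)
verbatim as its hypothesis, the regime becoming print's (3.35)–(3.36) classes of `bg9Y SU(N)` with thresholds `M₄`, `a₀` and one rate `δ₁` for the whole family.  (v) v1.1, §5
(CHECK-K, a located uniformity defect of the 𝒥-row's primitive rows): §4's flat sup `‖J(U)(b)‖ ≤ j` is `O(Mα₀(Lʲη)⁻³)` in print (N06's `norm_J_le_of_regYP336`), not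
member-uniform; §5 re-issues §4 along print's (3.136) route — `H₁` moved onto the current, only `η^{d+1}‖(H₁†J)(z)‖` on the output support of `D̃⁽²⁾` enters.

WHAT IS PROVED (standard axioms; no `sorry`; no definition).
* §1 ★★★ `eq324_CsDeltaCPY_opsYOfRecordV8E_trBasis_of_plaqSmall_onΛ_on_unit` — p676397 §3 keyed to `etaDY ∕ CsDeltaCPY` (same hypotheses, (3.24) for
  `𝒩(0, 𝕄_ι(CsDeltaCPY x 𝔏 𝔢 U)⁻¹)` at `𝔏 := lettersYOfRecordV4 (resYOfC2 𝔠) x`, `𝔢 := sectEYOfRecordV6 (sectEYWithDt2 (resYOfC2 𝔠) 𝔡₂ 𝔢₀) x`).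
* §2 ★★★ `eq324_CsDeltaCPY_opsYOfRecordV8E_trBasis_one_on_unit` — the `U = 1` edition: hypotheses = scalars, `2 ≤ d + 1`, an injective `Λ̃`-valued frame index
  `ι`, N06's (R2′a)|_Λ for `etaDY x • (QG₁Q\*)⁻¹(1)` with constants `(B_P, δ)`, `γ₀` for `CsDeltaCPY 1`; conclusion (3.24) for `𝒩(0, 𝕄_ι(CsDeltaCPY 1)⁻¹)`.
* §3 ★★★ `eq324_CsDeltaCPY_opsYOfRecordV8E_trBasis_of_ineq3132_onΛ_on_unit` — §1 with (R2′a)|_Λ REPLACED by `B9.Ineq3132 (θ.d₆+1) ((opsYNuOfRecordV4E N θ M⋆ (resYOfC2 𝔠)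
  𝔢 𝔴 𝔈 x).QG1Qinv) B_P δ U` (node N06's row 26 at `U`, BY NAME); ★★★ `eq324_CsDeltaCPY_opsYOfRecordV8E_trBasis_one_of_coercive_on_unit` — §2 with the P-row
  DISCHARGED (`4 ≤ ℓ`, member threshold `M₆ ≤ M`): (3.24) for `𝒩(0, 𝕄_ι(CsDeltaCPY 1)⁻¹)` modulo `γ₀` (R5′) at `U = 1` alone.
* §4 ★★★ `eq324_CsDeltaCPY_opsYOfRecordV8E_trBasis_of_ineq3132_of_JRows_onΛ_on_unit` — §3 with (R2′b)|_Λ REPLACED by n08-d's three primitive rows (`2 ≤ d + 1`);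
  ★★★ `eq324_CsDeltaCPY_opsYOfRecordV8E_trBasis_of_stmt3132Printed_onΛ_on_unit` — the family form: hypothesis `B9.Stmt3132Printed (θ.d₆+1) c35 geo9Y (bg9Y SU(N))
  (…QGQinv) (…QG1Qinv)` at the `ν`-read record over `resYOfC2 𝔠`; conclusion `∃ M₄ δ a₀, … ∃ b₁ ∀ b₀ ∃ C ∀ η ∀ x (M₄ ≤ M) ∀ α₀ (Mα₀ ≤ a₀) ∀ U ∈ Reg335 ∩ Reg336, …`
  the door with both N06-side rows by name (`U` is `SU(N)`-valued by `mem_of_reg335`).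
* §5 (v1.1) ★★★ `eq324_CsDeltaCPY_opsYOfRecordV8E_trBasis_of_ineq3132_of_adjCurrent_onΛ_on_unit` ∕ ★★★ `…_of_stmt3132Printed_of_adjCurrent_onΛ_on_unit` — §4's two
  theorems with the 𝒥-side rows REPLACED by (b†) a print-unit sup of the adjoint current `trAdjY (trDualMatY N) (H₁ U) (JY U)` on a free support predicate `S` and
  (c-out) the output support of `𝔡₂` in `S` (print's (3.136) route; member-uniform inputs; composition = seat n08-d's v1.1 of `…JRowCompositionAtNode00`, `JRowPrint_sectEYWithDt2_of_adjCurrent_onΛ`).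
* §6 (v1.2) ★★★ `eq324_CsDeltaCPY_opsYOfRecordV8E_trBasis_of_stmt3132Printed_R_of_adjCurrent_onΛ_on_unit (R₁ R₂) (hR : MemOfFam SU(N) R₁)` — §5's family form at
  def-Y's CLASS-PARAMETRIC carrier `bg9YR R₁ R₂` (hypothesis = n06-i's edition-8 face type `s3132Nu_opsYNuOfRecordV4E_R`; regime `R₁ x c35 α₀ U`, `R₂ x c35 α₀ U`);
  `bg9Y` and print's class `bg9YP` by `rfl`.
HONEST SCOPE.  Count-neutral compositions BY NAME of p676397, def-Y's print-unit letters and clauses, n08-d's `U = 1` 𝒥-row, geometry dictionary and 𝒥-row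
composition, n06-i's `U = 1` row-26 theorem and [B8]'s `plaqSmall_one`; nothing of node N06 at `U ≠ 1` asserted ((3.132) enters §3–§4 as the HYPOTHESIS
`B9.Ineq3132 …` ∕ `B9.Stmt3132Printed …`, N06's four Λ-normalised binders stay N06's; the column mass of `H₁`, the locality ∕ size of `D̃⁽²⁾` and the sup of `J`
are DISPLAYED primitive rows, not proved; `γ₀` (G-B9-09) stays displayed everywhere, at `U = 1` it is the positivity of `C\*Δ_kC(1)` on `Λ̃`-supported functions;
the plaquette smallness of the AVERAGED field is displayed next to (3.35)–(3.36) — its derivation from `Reg335` is [5] (55)–(58) content, not taken);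
[5]'s letters `𝔠`, `𝔡₂` enter the `U = 1` theorems only through their `U = 1` clauses; NORM DICTIONARY as in p673452 (L²-operator norm on `M_N(ℂ)` here,
Hilbert–Schmidt in [B9] p. 390 — the displayed rows are norm-sensitive by `N`-dependent constants); the IDENT (NODE 00's `(𝔖 k).μ = 𝒩(0, 𝕄_Λ̃(η^{d+1}C\*Δ_kC)⁻¹).map Φ`,
box, class-II Hamiltonian letters, window `b₁ < b₀`) is NOT made, NOT commissioned, NOT claimed; nothing of [Balaban1985UV3], [Balaban1985BackgroundPropagators],
[Balaban1985Averaging], [Balaban1984PropagatorsII], [Balaban1985RegularSpaces], [Balaban1982Higgs1] or [BenfattoEtAl1978] is asserted or discharged; node N08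
is NOT discharged; nothing about d = 4, the continuum, OS axioms, a mass gap or the Clay problem.
-/

noncomputable section

open MeasureTheory Finset Matrix

namespace Literature.MathematicalPhysics.QuantumFieldTheory.Balaban1983to89.B1Eq324BenfattoClassSectEMemberPrecisionDoorRowsByName

open Literature.MathematicalPhysics.QuantumFieldTheory
open Literature.MathematicalPhysics.QuantumFieldTheory.Balaban1983to89.B1Eq324BenfattoLemma
open Literature.MathematicalPhysics.QuantumFieldTheory.Balaban1983to89.B9PinMembersKLevelV1 (MemberY)
open Literature.MathematicalPhysics.QuantumFieldTheory.Balaban1983to89.B9PinGeometryKLevelV1 (unitDistY inΛY inΛY_top)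
open Literature.MathematicalPhysics.QuantumFieldTheory.Balaban1983to89.Node00

variable {d : ℕ}

/-! ## §1 The citable door keyed to def-Y's NAMED print-unit letter `CsDeltaCPY = η^{d+1}•C*Δ_kC` (`Node00.OpsYSectEPrintUnits`) -/

section ByName

open scoped Matrix.Norms.L2Operator
open B7Prop2Explicit (unitaryUnits)
open B9Thm311ReadingCoords (trIP IsSymmTr)
open B9CoReadingCoordsTranspose (trReForm trReForm_symm sum_trReForm_eq_trIP TrIdx trBasis)
open B1Eq324BenfattoClassSectEMemberRealAdjointAtNode00 (norm_trBasis_le lettersYOfRecordV4_QG1Qinv_isSymmTr)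
open B1Eq324BenfattoClassSectEMemberPrecisionDoorOnLambda (eq324_CsDeltaCY_precision_ofRecordTC_trBasis_onΛ_on_unit
  eq324_CsDeltaCY_precision_opsYOfRecordV8E_trBasis_of_plaqSmall_onΛ_on_unit)
open B1Eq324BenfattoClassSectEMemberJRowScaleAtNode00 (JRowPrint_one_record)
open B8Lemma1NonAbelian (pairTop)

/-- ★★★ **THE CITABLE (3.24) PRECISION DOOR AT NODE 00's v8 INSTANCE, KEYED TO def-Y's NAMED PRINT-UNIT LETTERS** — p676397
`eq324_CsDeltaCY_precision_opsYOfRecordV8E_trBasis_of_plaqSmall_onΛ_on_unit` VERBATIM with the inline scale `((L^k)⁻¹)^{d+1}` written as def-Y's `etaDY x`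
on the two displayed kernel readings and the precision letter written as def-Y's `CsDeltaCPY x 𝔏 𝔢 U = η^{d+1}•C*Δ_kC` (`Node00.OpsYSectEPrintUnits`, definitionally the
same token): the conclusion is [Balaban1982Higgs1] (3.24) for print's unit-lattice Gaussian `𝒩(0, 𝕄_ι(CsDeltaCPY U)⁻¹) = dμ_{C̃^{(k)}(Λ;U)}` ((3.158) in print units,
def-Y `CtildeKPY_eq_secInvY`).  Displayed rows exactly as there: `G ≤ U(N)`, `G`-valued `U`, plaquette smallness of the averaged field of record on every double
block with print's small-curvature numeral, [5]'s reality of `C⁽²⁾(U)`, `D̃⁽²⁾(U)`, node N06's (R2′a)|_Λ ∕ (R2′b)|_Λ readings and `γ₀` (R5′).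
[cite: Balaban1985BackgroundPropagators, (3.13) p.392, (3.35) p.396, (3.132) p.422, (3.156)–(3.158) p.428, Thm 3.11 p.416; Balaban1985Averaging, (55)–(58) p.27;
Balaban1985UV3, (24) p.262, pp.271–272; Balaban1982Higgs1, (3.24) p.616; BenfattoEtAl1978, Lemma (4.5)–(4.7) p.152 (class form; bent window, presentation and coordinates ours)] -/
theorem eq324_CsDeltaCPY_opsYOfRecordV8E_trBasis_of_plaqSmall_onΛ_on_unit (N : ℕ) [NeZero N] (θ : Stage3Params) (Mstar : ℕ)
    (𝔠 : C2Y N θ Mstar) (𝔡₂ : Dt2Y N θ Mstar) (𝔢₀ : SectEY N θ Mstar) {γ₀ BP KJ δ a : ℝ} (hγ₀ : 0 < γ₀) (hBP : 0 ≤ BP) (hKJ : 0 ≤ KJ) (hδ : 0 < δ)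
    (ha : 0 ≤ a) (hsmall : (((θ.ℓ₆ + 1 : ℕ) : ℝ)) ^ (θ.d₆ + 1) *
      (2 * ((((θ.d₆ * (2 * θ.ℓ₆ + 1) : ℕ) : ℝ)) * a) * (((θ.ℓ₆ + 1 : ℕ) + (θ.d₆ + 1) * θ.ℓ₆ : ℕ) : ℝ)) < 1) (t D : ℕ) {ϰ : ℝ} (hϰ : 0 < ϰ)
    {p₀ σ' c κ' : ℝ} (hp₀ : 2 / 3 < p₀) (hσ : 0 < σ') (hc : 0 ≤ c) (hκ : 0 < κ') (hκσ : κ' < σ' * (t + 1)) :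
    ∃ b₁ : ℝ, ∀ b₀ : ℝ, b₁ < b₀ → ∃ C : ℝ, 0 ≤ C ∧ ∀ η : ℝ, 0 < η → η ≤ 1 →
      ∀ (x : MemberY θ.d₆ θ.ℓ₆ θ.hd' θ.hL' θ.b₀ θ.b₁ Mstar) [DecidableEq (IBondY x.toKIdx)]
        {G : Subgroup (Matrix (Fin N) (Fin N) ℂ)ˣ}, G ≤ unitaryUnits (Matrix (Fin N) (Fin N) ℂ) →
      ∀ (U : CfgY (Matrix (Fin N) (Fin N) ℂ) x.toKIdx), (∀ μ z, U μ z ∈ G) →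
        (∀ c' : CBondY x, B8Lemma1NonAbelian.PlaqSmall (VzY x (avYOfRecord x U)) (labK x c'.1.1) (labK x c'.1.1 + pairTop (θ.ℓ₆ + 1) c'.1.2) a) →
        (∀ A A' : FBondY x.toKIdx → Matrix (Fin N) (Fin N) ℂ, (𝔠 x).form U (star A) (star A') = star ((𝔠 x).form U A A')) →
        (∀ B B' : IBondY x.toKIdx → Matrix (Fin N) (Fin N) ℂ, (𝔡₂ x).form U (star B) (star B') = star ((𝔡₂ x).form U B B')) →
      ∀ {σ : Type} [Fintype σ] [DecidableEq σ] [Nonempty σ] (ι : σ → IBondY x.toKIdx), Function.Injective ι → (∀ s, lamTY x (ι s)) →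
        (∀ u v : IBondY x.toKIdx, inΛY x u → inΛY x v →
          (⨆ E : BallY (Matrix (Fin N) (Fin N) ℂ), ‖(((etaDY x : ℝ) : ℂ) • (lettersYOfRecordV4 N θ Mstar (resYOfC2 N θ Mstar 𝔠) x).QG1Qinv U)
              (deltaY v (E : Matrix (Fin N) (Fin N) ℂ)) u‖) ≤
            BP * Real.exp (-(δ * unitDistY x u v))) →
        (∀ (u v : IBondY x.toKIdx) (E : Matrix (Fin N) (Fin N) ℂ), inΛY x u → inΛY x v →
          ‖((((etaDY x : ℝ) : ℂ) • (aY x.toKIdx + (sectEYWithDt2 N θ Mstar (resYOfC2 N θ Mstar 𝔠) 𝔡₂ 𝔢₀ x).D2J U)).restrictScalars ℝ)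
            (Pi.single v E) u‖ ≤ KJ * ‖E‖ * Real.exp (-(δ * unitDistY x u v))) →
        (∀ Φ : IBondY x.toKIdx → Matrix (Fin N) (Fin N) ℂ, (∀ u, u ∉ Set.range ι → Φ u = 0) →
          γ₀ * trIP (fun _ => (1 : ℝ)) Φ Φ ≤ trIP (fun _ => (1 : ℝ)) Φ ((CsDeltaCPY x (lettersYOfRecordV4 N θ Mstar (resYOfC2 N θ Mstar 𝔠) x)
            (sectEYOfRecordV6 N θ Mstar (sectEYWithDt2 N θ Mstar (resYOfC2 N θ Mstar 𝔠) 𝔡₂ 𝔢₀) x) U) Φ)) →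
      ∃ (Λ : Finset (B1Eq324BenfattoLemma.Site (θ.d₆ + 1 + (θ.d₆ + 1) + 1))) (e' : σ × TrIdx N ≃ ↥Λ),
        ((gaussianFieldOfKernel fun u w => if h : u ∈ Λ ∧ w ∈ Λ then
            ((Matrix.reindex e' e'
              (Matrix.of fun p q : σ × TrIdx N =>
                  trReForm (trBasis N p.2) (((CsDeltaCPY x (lettersYOfRecordV4 N θ Mstar (resYOfC2 N θ Mstar 𝔠) x)
            (sectEYOfRecordV6 N θ Mstar (sectEYWithDt2 N θ Mstar (resYOfC2 N θ Mstar 𝔠) 𝔡₂ 𝔢₀) x) U).restrictScalars ℝ)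
                    (Pi.single (ι q.1) (trBasis N q.2)) (ι p.1))))⁻¹ :
                Matrix ↥Λ ↥Λ ℝ) ⟨u, h.1⟩ ⟨w, h.2⟩ else 0).map
            (fun (z : B1Eq324BenfattoLemma.Site (θ.d₆ + 1 + (θ.d₆ + 1) + 1) → ℝ) (q : σ × TrIdx N) => z ((e' q : ↥Λ) : B1Eq324BenfattoLemma.Site (θ.d₆ + 1 + (θ.d₆ + 1) + 1))) =
          gaussianFieldOfKernel fun p q =>
            ((Matrix.of fun p q : σ × TrIdx N =>
                trReForm (trBasis N p.2) (((CsDeltaCPY x (lettersYOfRecordV4 N θ Mstar (resYOfC2 N θ Mstar 𝔠) x)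
            (sectEYOfRecordV6 N θ Mstar (sectEYWithDt2 N θ Mstar (resYOfC2 N θ Mstar 𝔠) 𝔡₂ 𝔢₀) x) U).restrictScalars ℝ)
                  (Pi.single (ι q.1) (trBasis N q.2)) (ι p.1)))⁻¹ :
              Matrix (σ × TrIdx N) (σ × TrIdx N) ℝ) p q) ∧
        (∀ p : ℝ, 0 ≤ p →
          ((fun (z : B1Eq324BenfattoLemma.Site (θ.d₆ + 1 + (θ.d₆ + 1) + 1) → ℝ) (q : σ × TrIdx N) => z ((e' q : ↥Λ) : B1Eq324BenfattoLemma.Site (θ.d₆ + 1 + (θ.d₆ + 1) + 1))) ⁻¹'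
              {ω : σ × TrIdx N → ℝ | ∀ q, |ω q| ≤ p}) =ᵐ[gaussianFieldOfKernel fun u w => if h : u ∈ Λ ∧ w ∈ Λ then
                ((Matrix.reindex e' e'
                  (Matrix.of fun p q : σ × TrIdx N =>
                      trReForm (trBasis N p.2) (((CsDeltaCPY x (lettersYOfRecordV4 N θ Mstar (resYOfC2 N θ Mstar 𝔠) x)
            (sectEYOfRecordV6 N θ Mstar (sectEYWithDt2 N θ Mstar (resYOfC2 N θ Mstar 𝔠) 𝔡₂ 𝔢₀) x) U).restrictScalars ℝ)
                        (Pi.single (ι q.1) (trBasis N q.2)) (ι p.1))))⁻¹ :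
                    Matrix ↥Λ ↥Λ ℝ) ⟨u, h.1⟩ ⟨w, h.2⟩ else 0]
            smallFieldSet Λ p) ∧
        ∀ (s : ℕ) (I J : Finset (B1Eq324BenfattoLemma.Site (θ.d₆ + 1 + (θ.d₆ + 1) + 1))) (𝔞 : Coef (θ.d₆ + 1 + (θ.d₆ + 1) + 1)),
          I.Nonempty → J ⊆ I → J ⊆ Λ → coefSup s D 𝔞 J ≤ c * η ^ σ' →
          0 < ∫ z, cutoffBoltzmann (hamiltonian s D ϰ 𝔞 J) I (B10.pFun b₀ p₀ η) z ∂(gaussianFieldOfKernel fun u w => if h : u ∈ Λ ∧ w ∈ Λ then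
              ((Matrix.reindex e' e'
                (Matrix.of fun p q : σ × TrIdx N =>
                    trReForm (trBasis N p.2) (((CsDeltaCPY x (lettersYOfRecordV4 N θ Mstar (resYOfC2 N θ Mstar 𝔠) x)
            (sectEYOfRecordV6 N θ Mstar (sectEYWithDt2 N θ Mstar (resYOfC2 N θ Mstar 𝔠) 𝔡₂ 𝔢₀) x) U).restrictScalars ℝ)
                      (Pi.single (ι q.1) (trBasis N q.2)) (ι p.1))))⁻¹ :
                  Matrix ↥Λ ↥Λ ℝ) ⟨u, h.1⟩ ⟨w, h.2⟩ else 0) ∧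
            |Real.log (∫ z, cutoffBoltzmann (hamiltonian s D ϰ 𝔞 J) I (B10.pFun b₀ p₀ η) z ∂(gaussianFieldOfKernel fun u w =>
                if h : u ∈ Λ ∧ w ∈ Λ then
                  ((Matrix.reindex e' e'
                    (Matrix.of fun p q : σ × TrIdx N =>
                        trReForm (trBasis N p.2) (((CsDeltaCPY x (lettersYOfRecordV4 N θ Mstar (resYOfC2 N θ Mstar 𝔠) x)
            (sectEYOfRecordV6 N θ Mstar (sectEYWithDt2 N θ Mstar (resYOfC2 N θ Mstar 𝔠) 𝔡₂ 𝔢₀) x) U).restrictScalars ℝ)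
                          (Pi.single (ι q.1) (trBasis N q.2)) (ι p.1))))⁻¹ :
                      Matrix ↥Λ ↥Λ ℝ) ⟨u, h.1⟩ ⟨w, h.2⟩ else 0)) -
              cumulantSum (gaussianFieldOfKernel fun u w => if h : u ∈ Λ ∧ w ∈ Λ then
                  ((Matrix.reindex e' e'
                    (Matrix.of fun p q : σ × TrIdx N =>
                        trReForm (trBasis N p.2) (((CsDeltaCPY x (lettersYOfRecordV4 N θ Mstar (resYOfC2 N θ Mstar 𝔠) x)
            (sectEYOfRecordV6 N θ Mstar (sectEYWithDt2 N θ Mstar (resYOfC2 N θ Mstar 𝔠) 𝔡₂ 𝔢₀) x) U).restrictScalars ℝ)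
                          (Pi.single (ι q.1) (trBasis N q.2)) (ι p.1))))⁻¹ :
                      Matrix ↥Λ ↥Λ ℝ) ⟨u, h.1⟩ ⟨w, h.2⟩ else 0)
                (hamiltonian s D ϰ 𝔞 J) t| ≤ C * η ^ κ' * I.card :=
  eq324_CsDeltaCY_precision_opsYOfRecordV8E_trBasis_of_plaqSmall_onΛ_on_unit N θ Mstar 𝔠 𝔡₂ 𝔢₀ hγ₀ hBP hKJ hδ ha hsmall t D hϰ hp₀ hσ hc hκ hκσ

/-! ## §2 The `U = 1` edition: at the trivial background every row but node N06's P-row and `γ₀` is a theorem -/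

/-- ★★★ **THE DOOR AT THE TRIVIAL BACKGROUND `U = 1`, NODE 00's v8 INSTANCE, PRINT UNITS — A NON-VACUITY CERTIFICATE OF ITS NODE-00 AND 𝒥-ROW SIDE,
UNIFORMLY IN `k`.**  At `U = 1`: `U` is `G`-valued for every `G` (internally `G := ⊥ ≤ U(N)`); the averaged field of record is `1` (def-Y `avYOfRecord_one`), so
print's plaquette smallness holds with `a := 0` ([B8] `B8Ineq130.plaqSmall_one`) and the small-curvature numeral reads `L^{d+1}·0 < 1`; (R1′) needs NO reality
of [5]'s letters — `Δ⁽²⁾(1) = 0` (the residual letter's clause `ResLettersY.Δ2_one`, a theorem of def-Y's `delta2OfY`) and `⟨D̃⁽²⁾·,J⟩(1) = 0` (`SectELettersY.D2J_one`,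
def-Y's `d2JOfY_one`: `J(1) = 0`), so `(QG₁Q*)⁻¹(1)` is symmetric by `lettersYOfRecordV4_QG1Qinv_isSymmTr` and the 𝒥-letter is `0`; the print-unit 𝒥-row
(R2′b)|_Λ is seat n08-d's THEOREM `JRowPrint_one_record` (`K_J := θ.b₁`, any rate; `2 ≤ d + 1`); pivot units, locality radius `ℓ + 2` and column mass as in
p676397 at `a = 0`.  DISPLAYED at `U = 1`: an injective `Λ̃`-valued frame index `ι`, node N06's (3.132) reading (R2′a)|_Λ of `η^{d+1}(QG₁Q*)⁻¹(1)` on Λ-bonds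
(N06's row 26 at `U = 1`) and `γ₀` (R5′) for `η^{d+1}C*Δ_kC(1)` (G-B9-09).  Conclusion: (3.24) for `𝒩(0, 𝕄_ι(CsDeltaCPY 1)⁻¹)`.
[cite: Balaban1985BackgroundPropagators, (3.132) p.422, (3.156)–(3.158) p.428, (3.26) p.395, Thm 3.11 p.416; Balaban1985RegularSpaces, p.98 («identically equal to 1
satisfies, of course, all possible regularity conditions»); Balaban1984PropagatorsII, (2.16) p.225; Balaban1985UV3, (24) p.262, pp.271–272; Balaban1982Higgs1, (3.24) p.616;
BenfattoEtAl1978, Lemma (4.5)–(4.7) p.152 (class form; bent window, presentation and coordinates ours)] -/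
theorem eq324_CsDeltaCPY_opsYOfRecordV8E_trBasis_one_on_unit (N : ℕ) [NeZero N] (θ : Stage3Params) (hD : 2 ≤ θ.d₆ + 1) (Mstar : ℕ)
    (𝔠 : C2Y N θ Mstar) (𝔡₂ : Dt2Y N θ Mstar) (𝔢₀ : SectEY N θ Mstar) {γ₀ BP δ : ℝ} (hγ₀ : 0 < γ₀) (hBP : 0 ≤ BP) (hδ : 0 < δ)
    (t D : ℕ) {ϰ : ℝ} (hϰ : 0 < ϰ)
    {p₀ σ' c κ' : ℝ} (hp₀ : 2 / 3 < p₀) (hσ : 0 < σ') (hc : 0 ≤ c) (hκ : 0 < κ') (hκσ : κ' < σ' * (t + 1)) :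
    ∃ b₁ : ℝ, ∀ b₀ : ℝ, b₁ < b₀ → ∃ C : ℝ, 0 ≤ C ∧ ∀ η : ℝ, 0 < η → η ≤ 1 →
      ∀ (x : MemberY θ.d₆ θ.ℓ₆ θ.hd' θ.hL' θ.b₀ θ.b₁ Mstar) [DecidableEq (IBondY x.toKIdx)]
      {σ : Type} [Fintype σ] [DecidableEq σ] [Nonempty σ] (ι : σ → IBondY x.toKIdx), Function.Injective ι → (∀ s, lamTY x (ι s)) →
        (∀ u v : IBondY x.toKIdx, inΛY x u → inΛY x v →
          (⨆ E : BallY (Matrix (Fin N) (Fin N) ℂ), ‖(((etaDY x : ℝ) : ℂ) • (lettersYOfRecordV4 N θ Mstar (resYOfC2 N θ Mstar 𝔠) x).QG1Qinv (fun _ _ => 1))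
              (deltaY v (E : Matrix (Fin N) (Fin N) ℂ)) u‖) ≤
            BP * Real.exp (-(δ * unitDistY x u v))) →
        (∀ Φ : IBondY x.toKIdx → Matrix (Fin N) (Fin N) ℂ, (∀ u, u ∉ Set.range ι → Φ u = 0) →
          γ₀ * trIP (fun _ => (1 : ℝ)) Φ Φ ≤ trIP (fun _ => (1 : ℝ)) Φ ((CsDeltaCPY x (lettersYOfRecordV4 N θ Mstar (resYOfC2 N θ Mstar 𝔠) x)
            (sectEYOfRecordV6 N θ Mstar (sectEYWithDt2 N θ Mstar (resYOfC2 N θ Mstar 𝔠) 𝔡₂ 𝔢₀) x) (fun _ _ => 1)) Φ)) →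
      ∃ (Λ : Finset (B1Eq324BenfattoLemma.Site (θ.d₆ + 1 + (θ.d₆ + 1) + 1))) (e' : σ × TrIdx N ≃ ↥Λ),
        ((gaussianFieldOfKernel fun u w => if h : u ∈ Λ ∧ w ∈ Λ then
            ((Matrix.reindex e' e'
              (Matrix.of fun p q : σ × TrIdx N =>
                  trReForm (trBasis N p.2) (((CsDeltaCPY x (lettersYOfRecordV4 N θ Mstar (resYOfC2 N θ Mstar 𝔠) x)
            (sectEYOfRecordV6 N θ Mstar (sectEYWithDt2 N θ Mstar (resYOfC2 N θ Mstar 𝔠) 𝔡₂ 𝔢₀) x) (fun _ _ => 1)).restrictScalars ℝ)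
                    (Pi.single (ι q.1) (trBasis N q.2)) (ι p.1))))⁻¹ :
                Matrix ↥Λ ↥Λ ℝ) ⟨u, h.1⟩ ⟨w, h.2⟩ else 0).map
            (fun (z : B1Eq324BenfattoLemma.Site (θ.d₆ + 1 + (θ.d₆ + 1) + 1) → ℝ) (q : σ × TrIdx N) => z ((e' q : ↥Λ) : B1Eq324BenfattoLemma.Site (θ.d₆ + 1 + (θ.d₆ + 1) + 1))) =
          gaussianFieldOfKernel fun p q =>
            ((Matrix.of fun p q : σ × TrIdx N =>
                trReForm (trBasis N p.2) (((CsDeltaCPY x (lettersYOfRecordV4 N θ Mstar (resYOfC2 N θ Mstar 𝔠) x)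
            (sectEYOfRecordV6 N θ Mstar (sectEYWithDt2 N θ Mstar (resYOfC2 N θ Mstar 𝔠) 𝔡₂ 𝔢₀) x) (fun _ _ => 1)).restrictScalars ℝ)
                  (Pi.single (ι q.1) (trBasis N q.2)) (ι p.1)))⁻¹ :
              Matrix (σ × TrIdx N) (σ × TrIdx N) ℝ) p q) ∧
        (∀ p : ℝ, 0 ≤ p →
          ((fun (z : B1Eq324BenfattoLemma.Site (θ.d₆ + 1 + (θ.d₆ + 1) + 1) → ℝ) (q : σ × TrIdx N) => z ((e' q : ↥Λ) : B1Eq324BenfattoLemma.Site (θ.d₆ + 1 + (θ.d₆ + 1) + 1))) ⁻¹'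
              {ω : σ × TrIdx N → ℝ | ∀ q, |ω q| ≤ p}) =ᵐ[gaussianFieldOfKernel fun u w => if h : u ∈ Λ ∧ w ∈ Λ then
                ((Matrix.reindex e' e'
                  (Matrix.of fun p q : σ × TrIdx N =>
                      trReForm (trBasis N p.2) (((CsDeltaCPY x (lettersYOfRecordV4 N θ Mstar (resYOfC2 N θ Mstar 𝔠) x)
            (sectEYOfRecordV6 N θ Mstar (sectEYWithDt2 N θ Mstar (resYOfC2 N θ Mstar 𝔠) 𝔡₂ 𝔢₀) x) (fun _ _ => 1)).restrictScalars ℝ)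
                        (Pi.single (ι q.1) (trBasis N q.2)) (ι p.1))))⁻¹ :
                    Matrix ↥Λ ↥Λ ℝ) ⟨u, h.1⟩ ⟨w, h.2⟩ else 0]
            smallFieldSet Λ p) ∧
        ∀ (s : ℕ) (I J : Finset (B1Eq324BenfattoLemma.Site (θ.d₆ + 1 + (θ.d₆ + 1) + 1))) (𝔞 : Coef (θ.d₆ + 1 + (θ.d₆ + 1) + 1)),
          I.Nonempty → J ⊆ I → J ⊆ Λ → coefSup s D 𝔞 J ≤ c * η ^ σ' →
          0 < ∫ z, cutoffBoltzmann (hamiltonian s D ϰ 𝔞 J) I (B10.pFun b₀ p₀ η) z ∂(gaussianFieldOfKernel fun u w => if h : u ∈ Λ ∧ w ∈ Λ then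
              ((Matrix.reindex e' e'
                (Matrix.of fun p q : σ × TrIdx N =>
                    trReForm (trBasis N p.2) (((CsDeltaCPY x (lettersYOfRecordV4 N θ Mstar (resYOfC2 N θ Mstar 𝔠) x)
            (sectEYOfRecordV6 N θ Mstar (sectEYWithDt2 N θ Mstar (resYOfC2 N θ Mstar 𝔠) 𝔡₂ 𝔢₀) x) (fun _ _ => 1)).restrictScalars ℝ)
                      (Pi.single (ι q.1) (trBasis N q.2)) (ι p.1))))⁻¹ :
                  Matrix ↥Λ ↥Λ ℝ) ⟨u, h.1⟩ ⟨w, h.2⟩ else 0) ∧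
            |Real.log (∫ z, cutoffBoltzmann (hamiltonian s D ϰ 𝔞 J) I (B10.pFun b₀ p₀ η) z ∂(gaussianFieldOfKernel fun u w =>
                if h : u ∈ Λ ∧ w ∈ Λ then
                  ((Matrix.reindex e' e'
                    (Matrix.of fun p q : σ × TrIdx N =>
                        trReForm (trBasis N p.2) (((CsDeltaCPY x (lettersYOfRecordV4 N θ Mstar (resYOfC2 N θ Mstar 𝔠) x)
            (sectEYOfRecordV6 N θ Mstar (sectEYWithDt2 N θ Mstar (resYOfC2 N θ Mstar 𝔠) 𝔡₂ 𝔢₀) x) (fun _ _ => 1)).restrictScalars ℝ)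
                          (Pi.single (ι q.1) (trBasis N q.2)) (ι p.1))))⁻¹ :
                      Matrix ↥Λ ↥Λ ℝ) ⟨u, h.1⟩ ⟨w, h.2⟩ else 0)) -
              cumulantSum (gaussianFieldOfKernel fun u w => if h : u ∈ Λ ∧ w ∈ Λ then
                  ((Matrix.reindex e' e'
                    (Matrix.of fun p q : σ × TrIdx N =>
                        trReForm (trBasis N p.2) (((CsDeltaCPY x (lettersYOfRecordV4 N θ Mstar (resYOfC2 N θ Mstar 𝔠) x)
            (sectEYOfRecordV6 N θ Mstar (sectEYWithDt2 N θ Mstar (resYOfC2 N θ Mstar 𝔠) 𝔡₂ 𝔢₀) x) (fun _ _ => 1)).restrictScalars ℝ)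
                          (Pi.single (ι q.1) (trBasis N q.2)) (ι p.1))))⁻¹ :
                      Matrix ↥Λ ↥Λ ℝ) ⟨u, h.1⟩ ⟨w, h.2⟩ else 0)
                (hamiltonian s D ϰ 𝔞 J) t| ≤ C * η ^ κ' * I.card := by
  have hKJ : (0 : ℝ) ≤ θ.b₁ := θ.hb.1.le.trans θ.hb.2
  have hsmall : (((θ.ℓ₆ + 1 : ℕ) : ℝ)) ^ (θ.d₆ + 1) *
      (2 * ((((θ.d₆ * (2 * θ.ℓ₆ + 1) : ℕ) : ℝ)) * (0 : ℝ)) * (((θ.ℓ₆ + 1 : ℕ) + (θ.d₆ + 1) * θ.ℓ₆ : ℕ) : ℝ)) < 1 := by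
    rw [mul_zero, mul_zero, zero_mul, mul_zero]; exact zero_lt_one
  have hκ0 : 0 < 1 - (((θ.ℓ₆ + 1 : ℕ) : ℝ)) ^ (θ.d₆ + 1) *
      (2 * ((((θ.d₆ * (2 * θ.ℓ₆ + 1) : ℕ) : ℝ)) * (0 : ℝ)) * (((θ.ℓ₆ + 1 : ℕ) + (θ.d₆ + 1) * θ.ℓ₆ : ℕ) : ℝ)) := sub_pos.2 hsmall
  have hm : (0 : ℝ) ≤ (1 + (1 - (((θ.ℓ₆ + 1 : ℕ) : ℝ)) ^ (θ.d₆ + 1) *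
      (2 * ((((θ.d₆ * (2 * θ.ℓ₆ + 1) : ℕ) : ℝ)) * (0 : ℝ)) * (((θ.ℓ₆ + 1 : ℕ) + (θ.d₆ + 1) * θ.ℓ₆ : ℕ) : ℝ)))⁻¹) * 1 := by
    rw [mul_one]; exact add_nonneg zero_le_one (inv_nonneg.2 hκ0.le)
  obtain ⟨b₁, hb₁⟩ := eq324_CsDeltaCY_precision_ofRecordTC_trBasis_onΛ_on_unit (d := θ.d₆) N hγ₀ hBP hKJ hδ hm t D hϰ hp₀ hσ hc hκ hκσ
    (r := (θ.ℓ₆ : ℝ) + 2)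
  refine ⟨b₁, fun b₀ hb₀ => ?_⟩
  obtain ⟨C, hC, hE⟩ := hb₁ b₀ hb₀
  refine ⟨C, hC, ?_⟩
  intro η hη hηle x _ σ _ _ _ ι hι hιT hProw hco
  have hG : (⊥ : Subgroup (Matrix (Fin N) (Fin N) ℂ)ˣ) ≤ unitaryUnits (Matrix (Fin N) (Fin N) ℂ) := bot_le
  have hU : ∀ μ z, (fun _ _ => 1 : CfgY (Matrix (Fin N) (Fin N) ℂ) x.toKIdx) μ z ∈ (⊥ : Subgroup (Matrix (Fin N) (Fin N) ℂ)ˣ) :=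
    fun _ _ => Subgroup.one_mem _
  have hV : VzY x (avYOfRecord x (fun _ _ => 1 : CfgY (Matrix (Fin N) (Fin N) ℂ) x.toKIdx)) = 1 := by
    funext w ν; simp [VzY]
  have hP : ∀ c' : CBondY x, B8Lemma1NonAbelian.PlaqSmall (VzY x (avYOfRecord x (fun _ _ => 1 : CfgY (Matrix (Fin N) (Fin N) ℂ) x.toKIdx)))
      (labK x c'.1.1) (labK x c'.1.1 + pairTop (θ.ℓ₆ + 1) c'.1.2) 0 := fun c' => by
    rw [hV]; exact B8Ineq130.plaqSmall_one le_rfl _ _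
  exact hE η hη hηle x (lettersYOfRecordV4 N θ Mstar (resYOfC2 N θ Mstar 𝔠) x) (avYOfRecord x)
    (sectEYWithDt2 N θ Mstar (resYOfC2 N θ Mstar 𝔠) 𝔡₂ 𝔢₀ x) (fun _ _ => 1) _ ι hι hιT
    (lettersYOfRecordV4_QG1Qinv_isSymmTr θ Mstar _ hG x hU (by rw [(resYOfC2 N θ Mstar 𝔠 x).Δ2_one]; exact isSymmTr_zero _))
    (by rw [(sectEYWithDt2 N θ Mstar (resYOfC2 N θ Mstar 𝔠) 𝔡₂ 𝔢₀ x).D2J_one]; exact isSymmTr_zero _)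
    hProw (fun u v E _ _ => JRowPrint_one_record θ hD x (sectEYWithDt2 N θ Mstar (resYOfC2 N θ Mstar 𝔠) 𝔡₂ 𝔢₀ x) δ u v E)
    (fun b => B7Prop2Explicit.mem_unitaryUnits.mp (hG (avYOfRecord_mem x hU b)))
    (fun c' => (isUnit_KY_KTY_avYOfRecord_of_plaqSmall N θ Mstar x hG hU c' le_rfl (hP c') hsmall).1)
    (fun c' => (isUnit_KY_KTY_avYOfRecord_of_plaqSmall N θ Mstar x hG hU c' le_rfl (hP c') hsmall).2)
    (B1Eq324BenfattoClassSectEMemberERowsAtNode00.local_elimC_sectEYOfRecordV6 N θ Mstar _ x (fun _ _ => 1) ι)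
    (B1Eq324BenfattoClassSectEMemberERowsAtNode00.colMass_elimC_sectEYOfRecordV6_of_plaqSmall N θ Mstar _ x hG hU le_rfl hP hsmall
      (fun c' => trBasis N c') norm_trBasis_le ι) hco

end ByName

/-! ## §3 The P-row BY NAME: node N06's numbered row 26 (`B9.Ineq3132` for the `ν`-read `(QG₁Q*)⁻¹` of record) replaces the displayed (R2′a)|_Λ —
per background (seat n08-d's top-level geometry dictionary `…PRowDictionaryAtNode00`), and at `U = 1` as a THEOREM (seat n06-i's `ineq3132Nu_one`) -/

section PRowByName

open scoped Matrix.Norms.L2Operator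
open B7Prop2Explicit (unitaryUnits)
open B7Prop2SpecialUnitary (specialUnitaryUnits)
open B9Thm311ReadingCoords (trIP IsSymmTr)
open B9CoReadingCoordsTranspose (trReForm trReForm_symm sum_trReForm_eq_trIP TrIdx trBasis)
open B8Lemma1NonAbelian (pairTop)
open B9PinMembersKLevelV1 (geo9Y bg9Y)
open B9Eq3132NuReading (siteKernelOfOpNu nuY opsYNuOfRecordV4E)
open B1Eq324BenfattoClassSectEMemberPRowDictionaryAtNode00 (pRowOnΛ_of_ineq3132_nu pRowOnΛ_opsYNuOfRecordV4E_of_ineq3132)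
open B6SectAVectorModelV1 (EE)
open B6GlobalChartV1 (domT)
open B6Ineq2133TwoScaleV1 (onFun)

/-- ★★★ **THE DOOR WITH ITS P-ROW BY NAME, PER BACKGROUND**: §1 with the displayed (R2′a)|_Λ REPLACED by node N06's numbered row 26 at the background `U` —
[B9] (3.132) for the `ν`-weighted reading of `(QG₁Q*)⁻¹(U)` at n06-i's repaired instance of record, `B9.Ineq3132 (d+1) ((opsYNuOfRecordV4E N θ M⋆ (resYOfC2 𝔠) 𝔢 𝔴 𝔈 x).QG1Qinv) B_P δ U`
(the conjunct of `B9.Stmt3132Printed` that `B9Eq3132NuReading.s3132Nu_opsYNuOfRecordV4E` concludes; any Sect.-E ∕ walk ∕ exponent families `𝔢 𝔴 𝔈` — the field does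
not see them) — through seat n08-d's top-level geometry dictionary `pRowOnΛ_opsYNuOfRecordV4E_of_ineq3132` (on Λ-bonds `ν(u)ν(v) = η^{d+1}`, `Lʲη = 1`, `|y − y′| ≤ d(y,y′)`).
Displayed otherwise as in §1: regime, [5]'s reality, the 𝒥-row (R2′b)|_Λ and `γ₀` (R5′).
[cite: Balaban1985BackgroundPropagators, (3.132) p.422, Thm 3.12 p.423, (3.154)–(3.158) pp.427–428, Thm 3.11 p.416; Balaban1984PropagatorsII, (2.149) p.249;
Balaban1985UV3, (24) p.262, pp.271–272; Balaban1982Higgs1, (3.24) p.616; BenfattoEtAl1978, Lemma (4.5)–(4.7) p.152 (class form; bent window, presentation and coordinates ours)] -/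
theorem eq324_CsDeltaCPY_opsYOfRecordV8E_trBasis_of_ineq3132_onΛ_on_unit (N : ℕ) [NeZero N] (θ : Stage3Params) (Mstar : ℕ)
    (𝔠 : C2Y N θ Mstar) (𝔡₂ : Dt2Y N θ Mstar) (𝔢₀ 𝔢 : SectEY N θ Mstar) (𝔴 : RWEY N θ Mstar) (𝔈 : ExpsY N θ Mstar) {γ₀ BP KJ δ a : ℝ}
    (hγ₀ : 0 < γ₀) (hBP : 0 ≤ BP) (hKJ : 0 ≤ KJ) (hδ : 0 < δ) (ha : 0 ≤ a) (hsmall : (((θ.ℓ₆ + 1 : ℕ) : ℝ)) ^ (θ.d₆ + 1) *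
      (2 * ((((θ.d₆ * (2 * θ.ℓ₆ + 1) : ℕ) : ℝ)) * a) * (((θ.ℓ₆ + 1 : ℕ) + (θ.d₆ + 1) * θ.ℓ₆ : ℕ) : ℝ)) < 1) (t D : ℕ) {ϰ : ℝ} (hϰ : 0 < ϰ)
    {p₀ σ' c κ' : ℝ} (hp₀ : 2 / 3 < p₀) (hσ : 0 < σ') (hc : 0 ≤ c) (hκ : 0 < κ') (hκσ : κ' < σ' * (t + 1)) :
    ∃ b₁ : ℝ, ∀ b₀ : ℝ, b₁ < b₀ → ∃ C : ℝ, 0 ≤ C ∧ ∀ η : ℝ, 0 < η → η ≤ 1 →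
      ∀ (x : MemberY θ.d₆ θ.ℓ₆ θ.hd' θ.hL' θ.b₀ θ.b₁ Mstar) [DecidableEq (IBondY x.toKIdx)]
        {G : Subgroup (Matrix (Fin N) (Fin N) ℂ)ˣ}, G ≤ unitaryUnits (Matrix (Fin N) (Fin N) ℂ) →
      ∀ (U : CfgY (Matrix (Fin N) (Fin N) ℂ) x.toKIdx), (∀ μ z, U μ z ∈ G) →
        (∀ c' : CBondY x, B8Lemma1NonAbelian.PlaqSmall (VzY x (avYOfRecord x U)) (labK x c'.1.1) (labK x c'.1.1 + pairTop (θ.ℓ₆ + 1) c'.1.2) a) →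
        (∀ A A' : FBondY x.toKIdx → Matrix (Fin N) (Fin N) ℂ, (𝔠 x).form U (star A) (star A') = star ((𝔠 x).form U A A')) →
        (∀ B B' : IBondY x.toKIdx → Matrix (Fin N) (Fin N) ℂ, (𝔡₂ x).form U (star B) (star B') = star ((𝔡₂ x).form U B B')) →
      ∀ {σ : Type} [Fintype σ] [DecidableEq σ] [Nonempty σ] (ι : σ → IBondY x.toKIdx), Function.Injective ι → (∀ s, lamTY x (ι s)) →
        B9.Ineq3132 (θ.d₆ + 1) (opsYNuOfRecordV4E N θ Mstar (resYOfC2 N θ Mstar 𝔠) 𝔢 𝔴 𝔈 x).QG1Qinv BP δ U →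
        (∀ (u v : IBondY x.toKIdx) (E : Matrix (Fin N) (Fin N) ℂ), inΛY x u → inΛY x v →
          ‖((((etaDY x : ℝ) : ℂ) • (aY x.toKIdx + (sectEYWithDt2 N θ Mstar (resYOfC2 N θ Mstar 𝔠) 𝔡₂ 𝔢₀ x).D2J U)).restrictScalars ℝ)
            (Pi.single v E) u‖ ≤ KJ * ‖E‖ * Real.exp (-(δ * unitDistY x u v))) →
        (∀ Φ : IBondY x.toKIdx → Matrix (Fin N) (Fin N) ℂ, (∀ u, u ∉ Set.range ι → Φ u = 0) →
          γ₀ * trIP (fun _ => (1 : ℝ)) Φ Φ ≤ trIP (fun _ => (1 : ℝ)) Φ ((CsDeltaCPY x (lettersYOfRecordV4 N θ Mstar (resYOfC2 N θ Mstar 𝔠) x)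
            (sectEYOfRecordV6 N θ Mstar (sectEYWithDt2 N θ Mstar (resYOfC2 N θ Mstar 𝔠) 𝔡₂ 𝔢₀) x) U) Φ)) →
      ∃ (Λ : Finset (B1Eq324BenfattoLemma.Site (θ.d₆ + 1 + (θ.d₆ + 1) + 1))) (e' : σ × TrIdx N ≃ ↥Λ),
        ((gaussianFieldOfKernel fun u w => if h : u ∈ Λ ∧ w ∈ Λ then
            ((Matrix.reindex e' e'
              (Matrix.of fun p q : σ × TrIdx N =>
                  trReForm (trBasis N p.2) (((CsDeltaCPY x (lettersYOfRecordV4 N θ Mstar (resYOfC2 N θ Mstar 𝔠) x)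
            (sectEYOfRecordV6 N θ Mstar (sectEYWithDt2 N θ Mstar (resYOfC2 N θ Mstar 𝔠) 𝔡₂ 𝔢₀) x) U).restrictScalars ℝ)
                    (Pi.single (ι q.1) (trBasis N q.2)) (ι p.1))))⁻¹ :
                Matrix ↥Λ ↥Λ ℝ) ⟨u, h.1⟩ ⟨w, h.2⟩ else 0).map
            (fun (z : B1Eq324BenfattoLemma.Site (θ.d₆ + 1 + (θ.d₆ + 1) + 1) → ℝ) (q : σ × TrIdx N) => z ((e' q : ↥Λ) : B1Eq324BenfattoLemma.Site (θ.d₆ + 1 + (θ.d₆ + 1) + 1))) =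
          gaussianFieldOfKernel fun p q =>
            ((Matrix.of fun p q : σ × TrIdx N =>
                trReForm (trBasis N p.2) (((CsDeltaCPY x (lettersYOfRecordV4 N θ Mstar (resYOfC2 N θ Mstar 𝔠) x)
            (sectEYOfRecordV6 N θ Mstar (sectEYWithDt2 N θ Mstar (resYOfC2 N θ Mstar 𝔠) 𝔡₂ 𝔢₀) x) U).restrictScalars ℝ)
                  (Pi.single (ι q.1) (trBasis N q.2)) (ι p.1)))⁻¹ :
              Matrix (σ × TrIdx N) (σ × TrIdx N) ℝ) p q) ∧
        (∀ p : ℝ, 0 ≤ p →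
          ((fun (z : B1Eq324BenfattoLemma.Site (θ.d₆ + 1 + (θ.d₆ + 1) + 1) → ℝ) (q : σ × TrIdx N) => z ((e' q : ↥Λ) : B1Eq324BenfattoLemma.Site (θ.d₆ + 1 + (θ.d₆ + 1) + 1))) ⁻¹'
              {ω : σ × TrIdx N → ℝ | ∀ q, |ω q| ≤ p}) =ᵐ[gaussianFieldOfKernel fun u w => if h : u ∈ Λ ∧ w ∈ Λ then
                ((Matrix.reindex e' e'
                  (Matrix.of fun p q : σ × TrIdx N =>
                      trReForm (trBasis N p.2) (((CsDeltaCPY x (lettersYOfRecordV4 N θ Mstar (resYOfC2 N θ Mstar 𝔠) x)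
            (sectEYOfRecordV6 N θ Mstar (sectEYWithDt2 N θ Mstar (resYOfC2 N θ Mstar 𝔠) 𝔡₂ 𝔢₀) x) U).restrictScalars ℝ)
                        (Pi.single (ι q.1) (trBasis N q.2)) (ι p.1))))⁻¹ :
                    Matrix ↥Λ ↥Λ ℝ) ⟨u, h.1⟩ ⟨w, h.2⟩ else 0]
            smallFieldSet Λ p) ∧
        ∀ (s : ℕ) (I J : Finset (B1Eq324BenfattoLemma.Site (θ.d₆ + 1 + (θ.d₆ + 1) + 1))) (𝔞 : Coef (θ.d₆ + 1 + (θ.d₆ + 1) + 1)),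
          I.Nonempty → J ⊆ I → J ⊆ Λ → coefSup s D 𝔞 J ≤ c * η ^ σ' →
          0 < ∫ z, cutoffBoltzmann (hamiltonian s D ϰ 𝔞 J) I (B10.pFun b₀ p₀ η) z ∂(gaussianFieldOfKernel fun u w => if h : u ∈ Λ ∧ w ∈ Λ then
              ((Matrix.reindex e' e'
                (Matrix.of fun p q : σ × TrIdx N =>
                    trReForm (trBasis N p.2) (((CsDeltaCPY x (lettersYOfRecordV4 N θ Mstar (resYOfC2 N θ Mstar 𝔠) x)
            (sectEYOfRecordV6 N θ Mstar (sectEYWithDt2 N θ Mstar (resYOfC2 N θ Mstar 𝔠) 𝔡₂ 𝔢₀) x) U).restrictScalars ℝ)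
                      (Pi.single (ι q.1) (trBasis N q.2)) (ι p.1))))⁻¹ :
                  Matrix ↥Λ ↥Λ ℝ) ⟨u, h.1⟩ ⟨w, h.2⟩ else 0) ∧
            |Real.log (∫ z, cutoffBoltzmann (hamiltonian s D ϰ 𝔞 J) I (B10.pFun b₀ p₀ η) z ∂(gaussianFieldOfKernel fun u w =>
                if h : u ∈ Λ ∧ w ∈ Λ then
                  ((Matrix.reindex e' e'
                    (Matrix.of fun p q : σ × TrIdx N =>
                        trReForm (trBasis N p.2) (((CsDeltaCPY x (lettersYOfRecordV4 N θ Mstar (resYOfC2 N θ Mstar 𝔠) x)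
            (sectEYOfRecordV6 N θ Mstar (sectEYWithDt2 N θ Mstar (resYOfC2 N θ Mstar 𝔠) 𝔡₂ 𝔢₀) x) U).restrictScalars ℝ)
                          (Pi.single (ι q.1) (trBasis N q.2)) (ι p.1))))⁻¹ :
                      Matrix ↥Λ ↥Λ ℝ) ⟨u, h.1⟩ ⟨w, h.2⟩ else 0)) -
              cumulantSum (gaussianFieldOfKernel fun u w => if h : u ∈ Λ ∧ w ∈ Λ then
                  ((Matrix.reindex e' e'
                    (Matrix.of fun p q : σ × TrIdx N =>
                        trReForm (trBasis N p.2) (((CsDeltaCPY x (lettersYOfRecordV4 N θ Mstar (resYOfC2 N θ Mstar 𝔠) x)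
            (sectEYOfRecordV6 N θ Mstar (sectEYWithDt2 N θ Mstar (resYOfC2 N θ Mstar 𝔠) 𝔡₂ 𝔢₀) x) U).restrictScalars ℝ)
                          (Pi.single (ι q.1) (trBasis N q.2)) (ι p.1))))⁻¹ :
                      Matrix ↥Λ ↥Λ ℝ) ⟨u, h.1⟩ ⟨w, h.2⟩ else 0)
                (hamiltonian s D ϰ 𝔞 J) t| ≤ C * η ^ κ' * I.card := by
  obtain ⟨b₁, hb₁⟩ := eq324_CsDeltaCPY_opsYOfRecordV8E_trBasis_of_plaqSmall_onΛ_on_unit N θ Mstar 𝔠 𝔡₂ 𝔢₀ hγ₀ hBP hKJ hδ ha hsmall t D hϰ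
    hp₀ hσ hc hκ hκσ
  refine ⟨b₁, fun b₀ hb₀ => ?_⟩
  obtain ⟨C, hC, hE⟩ := hb₁ b₀ hb₀
  refine ⟨C, hC, ?_⟩
  intro η hη hηle x _ G hG U hU hP hCr hDr σ _ _ _ ι hι hιT h3132 hJker hco
  exact hE η hη hηle x hG U hU hP hCr hDr ι hι hιT
    (fun u v hu hv => pRowOnΛ_opsYNuOfRecordV4E_of_ineq3132 θ Mstar (resYOfC2 N θ Mstar 𝔠) 𝔢 𝔴 𝔈 x (θ.d₆ + 1) hBP hδ.le U h3132 hu hv)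
    hJker hco

/-- ★★★ **THE DOOR AT `U = 1` MODULO `γ₀` ALONE** — §2 with its last N06 row DISCHARGED: at the trivial background the (3.132) reading (R2′a)|_Λ of
`η^{d+1}(QG₁Q*)⁻¹(1)` on Λ-bonds is a THEOREM for every member above a threshold `M₆` ([B9] Cor. 3.5 «for U = 1 these theorems are proved in [4]»: seat n06-i's
`B9Eq3132NuReadingAtOne.ineq3132Nu_one` — [4] Prop. 2.7 (2.149) with its coercivity (2.147) unconditional in the tree — at the v4 letters' `(QG₁Q*)⁻¹`, whose
`U = 1` value is [4]'s `(QGQ*)⁻¹(1) = (onFun EE)♯` by def-Y's `QGQinvY_one_liftEndY`, `QG1QinvY_one` and `Δ⁽²⁾(1) = 0`; read on Λ-bonds by seat n08-d's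
`pRowOnΛ_of_ineq3132_nu`).  HYPOTHESES LEFT: scalars, `2 ≤ d + 1`, `4 ≤ ℓ`, the member threshold `M₆ ≤ M`, an injective `Λ̃`-valued frame index `ι`, and `γ₀`
(R5′) for `CsDeltaCPY 1 = η^{d+1}C*Δ_kC(1)` on `ι`-supported `Φ` (G-B9-09, node N06's lower bound of Sect. E p. 428 at the trivial background).  Conclusion:
(3.24) for `𝒩(0, 𝕄_ι(CsDeltaCPY 1)⁻¹)`.
[cite: Balaban1985BackgroundPropagators, (3.132) p.422, Cor. 3.5 p.407, (3.156)–(3.158) p.428; Balaban1984PropagatorsII, Prop. 2.7 (2.149) p.249, (2.147) p.248;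
Balaban1985UV3, (24) p.262, pp.271–272; Balaban1982Higgs1, (3.24) p.616; BenfattoEtAl1978, Lemma (4.5)–(4.7) p.152 (class form; bent window, presentation and coordinates ours)] -/
theorem eq324_CsDeltaCPY_opsYOfRecordV8E_trBasis_one_of_coercive_on_unit (N : ℕ) [NeZero N] (θ : Stage3Params) (hD : 2 ≤ θ.d₆ + 1) (hℓ : 4 ≤ θ.ℓ₆)
    (Mstar : ℕ) (𝔠 : C2Y N θ Mstar) (𝔡₂ : Dt2Y N θ Mstar) (𝔢₀ : SectEY N θ Mstar) {γ₀ : ℝ} (hγ₀ : 0 < γ₀)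
    (t D : ℕ) {ϰ : ℝ} (hϰ : 0 < ϰ)
    {p₀ σ' c κ' : ℝ} (hp₀ : 2 / 3 < p₀) (hσ : 0 < σ') (hc : 0 ≤ c) (hκ : 0 < κ') (hκσ : κ' < σ' * (t + 1)) :
    ∃ M₆ b₁ : ℝ, ∀ b₀ : ℝ, b₁ < b₀ → ∃ C : ℝ, 0 ≤ C ∧ ∀ η : ℝ, 0 < η → η ≤ 1 →
      ∀ (x : MemberY θ.d₆ θ.ℓ₆ θ.hd' θ.hL' θ.b₀ θ.b₁ Mstar) [DecidableEq (IBondY x.toKIdx)], M₆ ≤ (geo9Y x).M →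
      ∀ {σ : Type} [Fintype σ] [DecidableEq σ] [Nonempty σ] (ι : σ → IBondY x.toKIdx), Function.Injective ι → (∀ s, lamTY x (ι s)) →
        (∀ Φ : IBondY x.toKIdx → Matrix (Fin N) (Fin N) ℂ, (∀ u, u ∉ Set.range ι → Φ u = 0) →
          γ₀ * trIP (fun _ => (1 : ℝ)) Φ Φ ≤ trIP (fun _ => (1 : ℝ)) Φ ((CsDeltaCPY x (lettersYOfRecordV4 N θ Mstar (resYOfC2 N θ Mstar 𝔠) x)
            (sectEYOfRecordV6 N θ Mstar (sectEYWithDt2 N θ Mstar (resYOfC2 N θ Mstar 𝔠) 𝔡₂ 𝔢₀) x) (fun _ _ => 1)) Φ)) →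
      ∃ (Λ : Finset (B1Eq324BenfattoLemma.Site (θ.d₆ + 1 + (θ.d₆ + 1) + 1))) (e' : σ × TrIdx N ≃ ↥Λ),
        ((gaussianFieldOfKernel fun u w => if h : u ∈ Λ ∧ w ∈ Λ then
            ((Matrix.reindex e' e'
              (Matrix.of fun p q : σ × TrIdx N =>
                  trReForm (trBasis N p.2) (((CsDeltaCPY x (lettersYOfRecordV4 N θ Mstar (resYOfC2 N θ Mstar 𝔠) x)
            (sectEYOfRecordV6 N θ Mstar (sectEYWithDt2 N θ Mstar (resYOfC2 N θ Mstar 𝔠) 𝔡₂ 𝔢₀) x) (fun _ _ => 1)).restrictScalars ℝ)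
                    (Pi.single (ι q.1) (trBasis N q.2)) (ι p.1))))⁻¹ :
                Matrix ↥Λ ↥Λ ℝ) ⟨u, h.1⟩ ⟨w, h.2⟩ else 0).map
            (fun (z : B1Eq324BenfattoLemma.Site (θ.d₆ + 1 + (θ.d₆ + 1) + 1) → ℝ) (q : σ × TrIdx N) => z ((e' q : ↥Λ) : B1Eq324BenfattoLemma.Site (θ.d₆ + 1 + (θ.d₆ + 1) + 1))) =
          gaussianFieldOfKernel fun p q =>
            ((Matrix.of fun p q : σ × TrIdx N =>
                trReForm (trBasis N p.2) (((CsDeltaCPY x (lettersYOfRecordV4 N θ Mstar (resYOfC2 N θ Mstar 𝔠) x)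
            (sectEYOfRecordV6 N θ Mstar (sectEYWithDt2 N θ Mstar (resYOfC2 N θ Mstar 𝔠) 𝔡₂ 𝔢₀) x) (fun _ _ => 1)).restrictScalars ℝ)
                  (Pi.single (ι q.1) (trBasis N q.2)) (ι p.1)))⁻¹ :
              Matrix (σ × TrIdx N) (σ × TrIdx N) ℝ) p q) ∧
        (∀ p : ℝ, 0 ≤ p →
          ((fun (z : B1Eq324BenfattoLemma.Site (θ.d₆ + 1 + (θ.d₆ + 1) + 1) → ℝ) (q : σ × TrIdx N) => z ((e' q : ↥Λ) : B1Eq324BenfattoLemma.Site (θ.d₆ + 1 + (θ.d₆ + 1) + 1))) ⁻¹'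
              {ω : σ × TrIdx N → ℝ | ∀ q, |ω q| ≤ p}) =ᵐ[gaussianFieldOfKernel fun u w => if h : u ∈ Λ ∧ w ∈ Λ then
                ((Matrix.reindex e' e'
                  (Matrix.of fun p q : σ × TrIdx N =>
                      trReForm (trBasis N p.2) (((CsDeltaCPY x (lettersYOfRecordV4 N θ Mstar (resYOfC2 N θ Mstar 𝔠) x)
            (sectEYOfRecordV6 N θ Mstar (sectEYWithDt2 N θ Mstar (resYOfC2 N θ Mstar 𝔠) 𝔡₂ 𝔢₀) x) (fun _ _ => 1)).restrictScalars ℝ)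
                        (Pi.single (ι q.1) (trBasis N q.2)) (ι p.1))))⁻¹ :
                    Matrix ↥Λ ↥Λ ℝ) ⟨u, h.1⟩ ⟨w, h.2⟩ else 0]
            smallFieldSet Λ p) ∧
        ∀ (s : ℕ) (I J : Finset (B1Eq324BenfattoLemma.Site (θ.d₆ + 1 + (θ.d₆ + 1) + 1))) (𝔞 : Coef (θ.d₆ + 1 + (θ.d₆ + 1) + 1)),
          I.Nonempty → J ⊆ I → J ⊆ Λ → coefSup s D 𝔞 J ≤ c * η ^ σ' →
          0 < ∫ z, cutoffBoltzmann (hamiltonian s D ϰ 𝔞 J) I (B10.pFun b₀ p₀ η) z ∂(gaussianFieldOfKernel fun u w => if h : u ∈ Λ ∧ w ∈ Λ then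
              ((Matrix.reindex e' e'
                (Matrix.of fun p q : σ × TrIdx N =>
                    trReForm (trBasis N p.2) (((CsDeltaCPY x (lettersYOfRecordV4 N θ Mstar (resYOfC2 N θ Mstar 𝔠) x)
            (sectEYOfRecordV6 N θ Mstar (sectEYWithDt2 N θ Mstar (resYOfC2 N θ Mstar 𝔠) 𝔡₂ 𝔢₀) x) (fun _ _ => 1)).restrictScalars ℝ)
                      (Pi.single (ι q.1) (trBasis N q.2)) (ι p.1))))⁻¹ :
                  Matrix ↥Λ ↥Λ ℝ) ⟨u, h.1⟩ ⟨w, h.2⟩ else 0) ∧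
            |Real.log (∫ z, cutoffBoltzmann (hamiltonian s D ϰ 𝔞 J) I (B10.pFun b₀ p₀ η) z ∂(gaussianFieldOfKernel fun u w =>
                if h : u ∈ Λ ∧ w ∈ Λ then
                  ((Matrix.reindex e' e'
                    (Matrix.of fun p q : σ × TrIdx N =>
                        trReForm (trBasis N p.2) (((CsDeltaCPY x (lettersYOfRecordV4 N θ Mstar (resYOfC2 N θ Mstar 𝔠) x)
            (sectEYOfRecordV6 N θ Mstar (sectEYWithDt2 N θ Mstar (resYOfC2 N θ Mstar 𝔠) 𝔡₂ 𝔢₀) x) (fun _ _ => 1)).restrictScalars ℝ)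
                          (Pi.single (ι q.1) (trBasis N q.2)) (ι p.1))))⁻¹ :
                      Matrix ↥Λ ↥Λ ℝ) ⟨u, h.1⟩ ⟨w, h.2⟩ else 0)) -
              cumulantSum (gaussianFieldOfKernel fun u w => if h : u ∈ Λ ∧ w ∈ Λ then
                  ((Matrix.reindex e' e'
                    (Matrix.of fun p q : σ × TrIdx N =>
                        trReForm (trBasis N p.2) (((CsDeltaCPY x (lettersYOfRecordV4 N θ Mstar (resYOfC2 N θ Mstar 𝔠) x)
            (sectEYOfRecordV6 N θ Mstar (sectEYWithDt2 N θ Mstar (resYOfC2 N θ Mstar 𝔠) 𝔡₂ 𝔢₀) x) (fun _ _ => 1)).restrictScalars ℝ)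
                          (Pi.single (ι q.1) (trBasis N q.2)) (ι p.1))))⁻¹ :
                      Matrix ↥Λ ↥Λ ℝ) ⟨u, h.1⟩ ⟨w, h.2⟩ else 0)
                (hamiltonian s D ϰ 𝔞 J) t| ≤ C * η ^ κ' * I.card := by
  have h0 : ∀ x : MemberY θ.d₆ θ.ℓ₆ θ.hd' θ.hL' θ.b₀ θ.b₁ Mstar,
      (lettersYOfRecordV4 N θ Mstar (resYOfC2 N θ Mstar 𝔠) x).QGQinv (fun _ _ => 1) =
        liftEndY (Matrix (Fin N) (Fin N) ℂ) (onFun (EE (domT x.hN x.D x.hk) x.hcf x.hw)) := fun x =>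
    B9Eq3132SectDLetters.QGQinvY_one_liftEndY x.toKIdx (lettersYOfRecordV4 N θ Mstar (resYOfC2 N θ Mstar 𝔠) x).parS_one
      (lettersYOfRecordV4 N θ Mstar (resYOfC2 N θ Mstar 𝔠) x).parB_one (lettersYOfRecordV4 N θ Mstar (resYOfC2 N θ Mstar 𝔠) x).Gp_one
  have h1 : ∀ x : MemberY θ.d₆ θ.ℓ₆ θ.hd' θ.hL' θ.b₀ θ.b₁ Mstar,
      (lettersYOfRecordV4 N θ Mstar (resYOfC2 N θ Mstar 𝔠) x).QG1Qinv (fun _ _ => 1) =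
        liftEndY (Matrix (Fin N) (Fin N) ℂ) (onFun (EE (domT x.hN x.D x.hk) x.hcf x.hw)) := fun x => by
    rw [← h0 x]
    exact QG1QinvY_one x.toKIdx _ _ _ ((resYOfC2 N θ Mstar 𝔠) x).Δ2_one
  obtain ⟨M₆, BP, δ, hBP, hδ, H⟩ := B9Eq3132NuReadingAtOne.ineq3132Nu_one (specialUnitaryUnits (Fin N)) hℓ θ.hb.1 θ.hb.2 (θ.d₆ + 1)
    (fun x => (lettersYOfRecordV4 N θ Mstar (resYOfC2 N θ Mstar 𝔠) x).QG1Qinv) h1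
  obtain ⟨b₁, hb₁⟩ := eq324_CsDeltaCPY_opsYOfRecordV8E_trBasis_one_on_unit N θ hD Mstar 𝔠 𝔡₂ 𝔢₀ hγ₀ hBP.le hδ t D hϰ hp₀ hσ hc hκ hκσ
  refine ⟨M₆, b₁, fun b₀ hb₀ => ?_⟩
  obtain ⟨C, hC, hE⟩ := hb₁ b₀ hb₀
  refine ⟨C, hC, ?_⟩
  intro η hη hηle x _ hMx σ _ _ _ ι hι hιT hco
  exact hE η hη hηle x ι hι hιT
    (fun u v hu hv => pRowOnΛ_of_ineq3132_nu x (lettersYOfRecordV4 N θ Mstar (resYOfC2 N θ Mstar 𝔠) x).QG1Qinv (θ.d₆ + 1) (θ.d₆ + 1)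
      hBP.le hδ.le (bg9Y (Matrix (Fin N) (Fin N) ℂ) (specialUnitaryUnits (Fin N)) x).one (H x hMx) hu hv) hco

end PRowByName

/-! ## §4 BOTH node-N06-side rows BY NAME: the 𝒥-row (R2′b)|_Λ as seat n08-d's composition `…JRowCompositionAtNode00` modulo its three primitive rows
(print-unit column mass of `H₁`, locality + size of the letter `D̃⁽²⁾`, a sup row for `J`), next to the P-row as `B9.Ineq3132`; and the family form over N06's
`B9.Stmt3132Printed` (the conclusion type of `s3132Nu_opsYNuOfRecordV4E`), regime by print's (3.35)–(3.36) -/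

section BothRowsByName

open scoped Matrix.Norms.L2Operator
open B7Prop2Explicit (unitaryUnits)
open B7Prop2SpecialUnitary (specialUnitaryUnits specialUnitaryUnits_le_unitaryUnits)
open B9Thm311ReadingCoords (trIP IsSymmTr)
open B9CoReadingCoordsTranspose (trReForm trReForm_symm sum_trReForm_eq_trIP TrIdx trBasis)
open B8Lemma1NonAbelian (pairTop)
open B9PinMembersKLevelV1 (geo9Y bg9Y)
open B9Eq3132NuReading (siteKernelOfOpNu nuY opsYNuOfRecordV4E)
open B1Eq324BenfattoClassSectEMemberJRowCompositionAtNode00 (JRowPrint_sectEYWithDt2_onΛ KJ_nonneg)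

/-- ★★★ **THE DOOR WITH BOTH N06-SIDE ROWS BY NAME, PER BACKGROUND.**  §3 with the displayed 𝒥-row (R2′b)|_Λ REPLACED by seat n08-d's composition
`JRowPrint_sectEYWithDt2_onΛ` (`K_J := θ.b₁ + 2N³·j·M_H·C₂·e^{δr₂}`, rate `δ` = the P-row's): the door's N06 ∕ [5] ∕ (3.117) inputs are now, verbatim, (a) node
N06's numbered row 26 at `U`, `B9.Ineq3132 (d+1) ((opsYNuOfRecordV4E … (resYOfC2 𝔠) 𝔢 𝔴 𝔈 x).QG1Qinv) B_P δ U`; (b) the print-unit column mass of `H₁(U)` —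
`η^{d+1}Σ_b ‖H₁(U)W(b)‖ ≤ M_H Σ_z ‖W(z)‖` (N06, Thm 3.12 ∕ p. 427 «the same situation for the operators H₁»); (c) locality radius `r₂` and size `C₂` of [5]'s letter
`D̃⁽²⁾(U)` on one-bond arguments (p. 427 «a quadratic polynomial in B with properties similar to C⁽²⁾(A), only restricted to unit blocks»); (d) `‖J(U)(b)‖ ≤ j`
((3.117), «J … is small, if U satisfies the condition (3.36)»); and `γ₀` (R5′).  Regime rows and [5]'s reality as in §1.  Conclusion (3.24) for `𝒩(0, 𝕄_ι(CsDeltaCPY U)⁻¹)`.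
[cite: Balaban1985BackgroundPropagators, (3.132) p.422, Thm 3.12 p.423, p.427, (3.117) p.419, (3.129) p.421, (3.156)–(3.158) p.428, Thm 3.11 p.416; Balaban1985Averaging, (136) p.39;
Balaban1984PropagatorsII, (2.149) p.249, (2.16) p.225; Balaban1985UV3, (24) p.262, pp.271–272; Balaban1982Higgs1, (3.24) p.616; BenfattoEtAl1978, Lemma (4.5)–(4.7) p.152
(class form; bent window, presentation and coordinates ours)] -/
theorem eq324_CsDeltaCPY_opsYOfRecordV8E_trBasis_of_ineq3132_of_JRows_onΛ_on_unit (N : ℕ) [NeZero N] (θ : Stage3Params) (hD : 2 ≤ θ.d₆ + 1) (Mstar : ℕ)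
    (𝔠 : C2Y N θ Mstar) (𝔡₂ : Dt2Y N θ Mstar) (𝔢₀ 𝔢 : SectEY N θ Mstar) (𝔴 : RWEY N θ Mstar) (𝔈 : ExpsY N θ Mstar) {γ₀ BP δ a MH j C₂ r₂ : ℝ}
    (hγ₀ : 0 < γ₀) (hBP : 0 ≤ BP) (hδ : 0 < δ) (ha : 0 ≤ a) (hMH : 0 ≤ MH) (hj : 0 ≤ j) (hC₂ : 0 ≤ C₂) (hsmall : (((θ.ℓ₆ + 1 : ℕ) : ℝ)) ^ (θ.d₆ + 1) *
      (2 * ((((θ.d₆ * (2 * θ.ℓ₆ + 1) : ℕ) : ℝ)) * a) * (((θ.ℓ₆ + 1 : ℕ) + (θ.d₆ + 1) * θ.ℓ₆ : ℕ) : ℝ)) < 1)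
    (t D : ℕ) {ϰ : ℝ} (hϰ : 0 < ϰ)
    {p₀ σ' c κ' : ℝ} (hp₀ : 2 / 3 < p₀) (hσ : 0 < σ') (hc : 0 ≤ c) (hκ : 0 < κ') (hκσ : κ' < σ' * (t + 1)) :
    ∃ b₁ : ℝ, ∀ b₀ : ℝ, b₁ < b₀ → ∃ C : ℝ, 0 ≤ C ∧ ∀ η : ℝ, 0 < η → η ≤ 1 →
      ∀ (x : MemberY θ.d₆ θ.ℓ₆ θ.hd' θ.hL' θ.b₀ θ.b₁ Mstar) [DecidableEq (IBondY x.toKIdx)]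
        {G : Subgroup (Matrix (Fin N) (Fin N) ℂ)ˣ}, G ≤ unitaryUnits (Matrix (Fin N) (Fin N) ℂ) →
      ∀ (U : CfgY (Matrix (Fin N) (Fin N) ℂ) x.toKIdx), (∀ μ z, U μ z ∈ G) →
        (∀ c' : CBondY x, B8Lemma1NonAbelian.PlaqSmall (VzY x (avYOfRecord x U)) (labK x c'.1.1) (labK x c'.1.1 + pairTop (θ.ℓ₆ + 1) c'.1.2) a) →
        (∀ A A' : FBondY x.toKIdx → Matrix (Fin N) (Fin N) ℂ, (𝔠 x).form U (star A) (star A') = star ((𝔠 x).form U A A')) →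
        (∀ B B' : IBondY x.toKIdx → Matrix (Fin N) (Fin N) ℂ, (𝔡₂ x).form U (star B) (star B') = star ((𝔡₂ x).form U B B')) →
      ∀ {σ : Type} [Fintype σ] [DecidableEq σ] [Nonempty σ] (ι : σ → IBondY x.toKIdx), Function.Injective ι → (∀ s, lamTY x (ι s)) →
        B9.Ineq3132 (θ.d₆ + 1) (opsYNuOfRecordV4E N θ Mstar (resYOfC2 N θ Mstar 𝔠) 𝔢 𝔴 𝔈 x).QG1Qinv BP δ U →
        (∀ W : IBondY x.toKIdx → Matrix (Fin N) (Fin N) ℂ,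
          etaDY x * ∑ b, ‖(lettersYOfRecordV4 N θ Mstar (resYOfC2 N θ Mstar 𝔠) x).H₁ U W b‖ ≤ MH * ∑ z, ‖W z‖) →
        (∀ b, ‖JY x.toKIdx U b‖ ≤ j) →
        (∀ (u v : IBondY x.toKIdx) (E a : Matrix (Fin N) (Fin N) ℂ), r₂ < unitDistY x u v → (𝔡₂ x).form U (Pi.single v E) (Pi.single u a) = 0) →
        (∀ (u v : IBondY x.toKIdx) (E a : Matrix (Fin N) (Fin N) ℂ), ∑ z, ‖(𝔡₂ x).form U (Pi.single v E) (Pi.single u a) z‖ ≤ C₂ * ‖E‖ * ‖a‖) →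
        (∀ Φ : IBondY x.toKIdx → Matrix (Fin N) (Fin N) ℂ, (∀ u, u ∉ Set.range ι → Φ u = 0) →
          γ₀ * trIP (fun _ => (1 : ℝ)) Φ Φ ≤ trIP (fun _ => (1 : ℝ)) Φ ((CsDeltaCPY x (lettersYOfRecordV4 N θ Mstar (resYOfC2 N θ Mstar 𝔠) x)
            (sectEYOfRecordV6 N θ Mstar (sectEYWithDt2 N θ Mstar (resYOfC2 N θ Mstar 𝔠) 𝔡₂ 𝔢₀) x) U) Φ)) →
      ∃ (Λ : Finset (B1Eq324BenfattoLemma.Site (θ.d₆ + 1 + (θ.d₆ + 1) + 1))) (e' : σ × TrIdx N ≃ ↥Λ),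
        ((gaussianFieldOfKernel fun u w => if h : u ∈ Λ ∧ w ∈ Λ then
            ((Matrix.reindex e' e'
              (Matrix.of fun p q : σ × TrIdx N =>
                  trReForm (trBasis N p.2) (((CsDeltaCPY x (lettersYOfRecordV4 N θ Mstar (resYOfC2 N θ Mstar 𝔠) x)
            (sectEYOfRecordV6 N θ Mstar (sectEYWithDt2 N θ Mstar (resYOfC2 N θ Mstar 𝔠) 𝔡₂ 𝔢₀) x) U).restrictScalars ℝ)
                    (Pi.single (ι q.1) (trBasis N q.2)) (ι p.1))))⁻¹ :
                Matrix ↥Λ ↥Λ ℝ) ⟨u, h.1⟩ ⟨w, h.2⟩ else 0).map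
            (fun (z : B1Eq324BenfattoLemma.Site (θ.d₆ + 1 + (θ.d₆ + 1) + 1) → ℝ) (q : σ × TrIdx N) => z ((e' q : ↥Λ) : B1Eq324BenfattoLemma.Site (θ.d₆ + 1 + (θ.d₆ + 1) + 1))) =
          gaussianFieldOfKernel fun p q =>
            ((Matrix.of fun p q : σ × TrIdx N =>
                trReForm (trBasis N p.2) (((CsDeltaCPY x (lettersYOfRecordV4 N θ Mstar (resYOfC2 N θ Mstar 𝔠) x)
            (sectEYOfRecordV6 N θ Mstar (sectEYWithDt2 N θ Mstar (resYOfC2 N θ Mstar 𝔠) 𝔡₂ 𝔢₀) x) U).restrictScalars ℝ)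
                  (Pi.single (ι q.1) (trBasis N q.2)) (ι p.1)))⁻¹ :
              Matrix (σ × TrIdx N) (σ × TrIdx N) ℝ) p q) ∧
        (∀ p : ℝ, 0 ≤ p →
          ((fun (z : B1Eq324BenfattoLemma.Site (θ.d₆ + 1 + (θ.d₆ + 1) + 1) → ℝ) (q : σ × TrIdx N) => z ((e' q : ↥Λ) : B1Eq324BenfattoLemma.Site (θ.d₆ + 1 + (θ.d₆ + 1) + 1))) ⁻¹'
              {ω : σ × TrIdx N → ℝ | ∀ q, |ω q| ≤ p}) =ᵐ[gaussianFieldOfKernel fun u w => if h : u ∈ Λ ∧ w ∈ Λ then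
                ((Matrix.reindex e' e'
                  (Matrix.of fun p q : σ × TrIdx N =>
                      trReForm (trBasis N p.2) (((CsDeltaCPY x (lettersYOfRecordV4 N θ Mstar (resYOfC2 N θ Mstar 𝔠) x)
            (sectEYOfRecordV6 N θ Mstar (sectEYWithDt2 N θ Mstar (resYOfC2 N θ Mstar 𝔠) 𝔡₂ 𝔢₀) x) U).restrictScalars ℝ)
                        (Pi.single (ι q.1) (trBasis N q.2)) (ι p.1))))⁻¹ :
                    Matrix ↥Λ ↥Λ ℝ) ⟨u, h.1⟩ ⟨w, h.2⟩ else 0]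
            smallFieldSet Λ p) ∧
        ∀ (s : ℕ) (I J : Finset (B1Eq324BenfattoLemma.Site (θ.d₆ + 1 + (θ.d₆ + 1) + 1))) (𝔞 : Coef (θ.d₆ + 1 + (θ.d₆ + 1) + 1)),
          I.Nonempty → J ⊆ I → J ⊆ Λ → coefSup s D 𝔞 J ≤ c * η ^ σ' →
          0 < ∫ z, cutoffBoltzmann (hamiltonian s D ϰ 𝔞 J) I (B10.pFun b₀ p₀ η) z ∂(gaussianFieldOfKernel fun u w => if h : u ∈ Λ ∧ w ∈ Λ then
              ((Matrix.reindex e' e'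
                (Matrix.of fun p q : σ × TrIdx N =>
                    trReForm (trBasis N p.2) (((CsDeltaCPY x (lettersYOfRecordV4 N θ Mstar (resYOfC2 N θ Mstar 𝔠) x)
            (sectEYOfRecordV6 N θ Mstar (sectEYWithDt2 N θ Mstar (resYOfC2 N θ Mstar 𝔠) 𝔡₂ 𝔢₀) x) U).restrictScalars ℝ)
                      (Pi.single (ι q.1) (trBasis N q.2)) (ι p.1))))⁻¹ :
                  Matrix ↥Λ ↥Λ ℝ) ⟨u, h.1⟩ ⟨w, h.2⟩ else 0) ∧
            |Real.log (∫ z, cutoffBoltzmann (hamiltonian s D ϰ 𝔞 J) I (B10.pFun b₀ p₀ η) z ∂(gaussianFieldOfKernel fun u w =>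
                if h : u ∈ Λ ∧ w ∈ Λ then
                  ((Matrix.reindex e' e'
                    (Matrix.of fun p q : σ × TrIdx N =>
                        trReForm (trBasis N p.2) (((CsDeltaCPY x (lettersYOfRecordV4 N θ Mstar (resYOfC2 N θ Mstar 𝔠) x)
            (sectEYOfRecordV6 N θ Mstar (sectEYWithDt2 N θ Mstar (resYOfC2 N θ Mstar 𝔠) 𝔡₂ 𝔢₀) x) U).restrictScalars ℝ)
                          (Pi.single (ι q.1) (trBasis N q.2)) (ι p.1))))⁻¹ :
                      Matrix ↥Λ ↥Λ ℝ) ⟨u, h.1⟩ ⟨w, h.2⟩ else 0)) -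
              cumulantSum (gaussianFieldOfKernel fun u w => if h : u ∈ Λ ∧ w ∈ Λ then
                  ((Matrix.reindex e' e'
                    (Matrix.of fun p q : σ × TrIdx N =>
                        trReForm (trBasis N p.2) (((CsDeltaCPY x (lettersYOfRecordV4 N θ Mstar (resYOfC2 N θ Mstar 𝔠) x)
            (sectEYOfRecordV6 N θ Mstar (sectEYWithDt2 N θ Mstar (resYOfC2 N θ Mstar 𝔠) 𝔡₂ 𝔢₀) x) U).restrictScalars ℝ)
                          (Pi.single (ι q.1) (trBasis N q.2)) (ι p.1))))⁻¹ :
                      Matrix ↥Λ ↥Λ ℝ) ⟨u, h.1⟩ ⟨w, h.2⟩ else 0)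
                (hamiltonian s D ϰ 𝔞 J) t| ≤ C * η ^ κ' * I.card := by
  obtain ⟨b₁, hb₁⟩ := eq324_CsDeltaCPY_opsYOfRecordV8E_trBasis_of_ineq3132_onΛ_on_unit N θ Mstar 𝔠 𝔡₂ 𝔢₀ 𝔢 𝔴 𝔈 hγ₀ hBP
    (KJ_nonneg (N := N) (r₂ := r₂) (δ := δ) θ hj hMH hC₂) hδ ha hsmall t D hϰ hp₀ hσ hc hκ hκσ
  refine ⟨b₁, fun b₀ hb₀ => ?_⟩
  obtain ⟨C, hC, hE⟩ := hb₁ b₀ hb₀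
  refine ⟨C, hC, ?_⟩
  intro η hη hηle x _ G hG U hU hP hCr hDr σ _ _ _ ι hι hιT h3132 hH hJ hDloc hDsz hco
  exact hE η hη hηle x hG U hU hP hCr hDr ι hι hιT h3132
    (JRowPrint_sectEYWithDt2_onΛ θ Mstar (resYOfC2 N θ Mstar 𝔠) 𝔡₂ 𝔢₀ hD x U hMH hj hC₂ hδ.le hH hJ hDloc hDsz) hco

/-- ★★★ **THE FAMILY FORM OVER NODE N06's ROW 26** — the conclusion TYPE of n06-i's `B9Eq3132NuReading.s3132Nu_opsYNuOfRecordV4E`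
(`B9.Stmt3132Printed (d+1) c35 geo9Y (bg9Y SU(N)) (…QGQinv) (…QG1Qinv)` at the `ν`-read record over `resYOfC2 𝔠`) taken VERBATIM as the hypothesis: it yields print's
thresholds `M₄`, `a₀` and ONE rate `δ₁` for the whole Stage-3′ family, and then, for every member above `M₄`, every `α₀` with `Mα₀ ≤ a₀` and every background in print's
classes (3.35)–(3.36) (`Reg335 ∕ Reg336` of `bg9Y SU(N)` — so `U` is `SU(N)`-valued, `B9BackgroundsKLevelV1.mem_of_reg335`), the door of the previous theorem with the
P-row DISCHARGED by N06's row (seat n08-d's dictionary) and the 𝒥-row composed at the rate `δ₁`.  DISPLAYED: plaquette smallness of the averaged field of record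
(print's small-curvature numeral), [5]'s reality of `C⁽²⁾(U)`, `D̃⁽²⁾(U)`, the three primitive rows (b)(c)(d) of the previous theorem, `γ₀` (R5′).
[cite: Balaban1985BackgroundPropagators, (3.132) p.422, Thm 3.12 p.423, (3.35)–(3.36) p.396, p.427, (3.117) p.419, (3.156)–(3.158) p.428; Balaban1985Averaging, (136) p.39;
Balaban1984PropagatorsII, (2.149) p.249; Balaban1985UV3, (24) p.262, pp.271–272; Balaban1982Higgs1, (3.24) p.616; BenfattoEtAl1978, Lemma (4.5)–(4.7) p.152
(class form; bent window, presentation and coordinates ours)] -/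
theorem eq324_CsDeltaCPY_opsYOfRecordV8E_trBasis_of_stmt3132Printed_onΛ_on_unit (N : ℕ) [NeZero N] (θ : Stage3Params) (hD : 2 ≤ θ.d₆ + 1) (Mstar : ℕ)
    (𝔠 : C2Y N θ Mstar) (𝔡₂ : Dt2Y N θ Mstar) (𝔢₀ 𝔢 : SectEY N θ Mstar) (𝔴 : RWEY N θ Mstar) (𝔈 : ExpsY N θ Mstar) {c35 : ℝ}
    (h26 : B9.Stmt3132Printed (θ.d₆ + 1) c35
      (geo9Y (d := θ.d₆) (ℓ := θ.ℓ₆) (hd := θ.hd') (hL := θ.hL') (b₀ := θ.b₀) (b₁ := θ.b₁) (Mstar := Mstar))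
      (bg9Y (Matrix (Fin N) (Fin N) ℂ) (specialUnitaryUnits (Fin N)))
      (fun x => (opsYNuOfRecordV4E N θ Mstar (resYOfC2 N θ Mstar 𝔠) 𝔢 𝔴 𝔈 x).QGQinv)
      (fun x => (opsYNuOfRecordV4E N θ Mstar (resYOfC2 N θ Mstar 𝔠) 𝔢 𝔴 𝔈 x).QG1Qinv))
    {γ₀ a MH j C₂ r₂ : ℝ} (hγ₀ : 0 < γ₀) (ha : 0 ≤ a) (hMH : 0 ≤ MH) (hj : 0 ≤ j) (hC₂ : 0 ≤ C₂) (hsmall : (((θ.ℓ₆ + 1 : ℕ) : ℝ)) ^ (θ.d₆ + 1) *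
      (2 * ((((θ.d₆ * (2 * θ.ℓ₆ + 1) : ℕ) : ℝ)) * a) * (((θ.ℓ₆ + 1 : ℕ) + (θ.d₆ + 1) * θ.ℓ₆ : ℕ) : ℝ)) < 1)
    (t D : ℕ) {ϰ : ℝ} (hϰ : 0 < ϰ)
    {p₀ σ' c κ' : ℝ} (hp₀ : 2 / 3 < p₀) (hσ : 0 < σ') (hc : 0 ≤ c) (hκ : 0 < κ') (hκσ : κ' < σ' * (t + 1)) :
    ∃ M₄ δ a₀ : ℝ, 0 < M₄ ∧ 0 < δ ∧ 0 < a₀ ∧ ∃ b₁ : ℝ, ∀ b₀ : ℝ, b₁ < b₀ → ∃ C : ℝ, 0 ≤ C ∧ ∀ η : ℝ, 0 < η → η ≤ 1 →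
      ∀ (x : MemberY θ.d₆ θ.ℓ₆ θ.hd' θ.hL' θ.b₀ θ.b₁ Mstar) [DecidableEq (IBondY x.toKIdx)], M₄ ≤ (geo9Y x).M →
      ∀ α₀ : ℝ, 0 < α₀ → (geo9Y x).M * α₀ ≤ a₀ →
      ∀ (U : CfgY (Matrix (Fin N) (Fin N) ℂ) x.toKIdx),
        (bg9Y (Matrix (Fin N) (Fin N) ℂ) (specialUnitaryUnits (Fin N)) x).Reg335 c35 α₀ U →
        (bg9Y (Matrix (Fin N) (Fin N) ℂ) (specialUnitaryUnits (Fin N)) x).Reg336 c35 α₀ U →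
        (∀ c' : CBondY x, B8Lemma1NonAbelian.PlaqSmall (VzY x (avYOfRecord x U)) (labK x c'.1.1) (labK x c'.1.1 + pairTop (θ.ℓ₆ + 1) c'.1.2) a) →
        (∀ A A' : FBondY x.toKIdx → Matrix (Fin N) (Fin N) ℂ, (𝔠 x).form U (star A) (star A') = star ((𝔠 x).form U A A')) →
        (∀ B B' : IBondY x.toKIdx → Matrix (Fin N) (Fin N) ℂ, (𝔡₂ x).form U (star B) (star B') = star ((𝔡₂ x).form U B B')) →
      ∀ {σ : Type} [Fintype σ] [DecidableEq σ] [Nonempty σ] (ι : σ → IBondY x.toKIdx), Function.Injective ι → (∀ s, lamTY x (ι s)) →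
        (∀ W : IBondY x.toKIdx → Matrix (Fin N) (Fin N) ℂ,
          etaDY x * ∑ b, ‖(lettersYOfRecordV4 N θ Mstar (resYOfC2 N θ Mstar 𝔠) x).H₁ U W b‖ ≤ MH * ∑ z, ‖W z‖) →
        (∀ b, ‖JY x.toKIdx U b‖ ≤ j) →
        (∀ (u v : IBondY x.toKIdx) (E a : Matrix (Fin N) (Fin N) ℂ), r₂ < unitDistY x u v → (𝔡₂ x).form U (Pi.single v E) (Pi.single u a) = 0) →
        (∀ (u v : IBondY x.toKIdx) (E a : Matrix (Fin N) (Fin N) ℂ), ∑ z, ‖(𝔡₂ x).form U (Pi.single v E) (Pi.single u a) z‖ ≤ C₂ * ‖E‖ * ‖a‖) →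
        (∀ Φ : IBondY x.toKIdx → Matrix (Fin N) (Fin N) ℂ, (∀ u, u ∉ Set.range ι → Φ u = 0) →
          γ₀ * trIP (fun _ => (1 : ℝ)) Φ Φ ≤ trIP (fun _ => (1 : ℝ)) Φ ((CsDeltaCPY x (lettersYOfRecordV4 N θ Mstar (resYOfC2 N θ Mstar 𝔠) x)
            (sectEYOfRecordV6 N θ Mstar (sectEYWithDt2 N θ Mstar (resYOfC2 N θ Mstar 𝔠) 𝔡₂ 𝔢₀) x) U) Φ)) →
      ∃ (Λ : Finset (B1Eq324BenfattoLemma.Site (θ.d₆ + 1 + (θ.d₆ + 1) + 1))) (e' : σ × TrIdx N ≃ ↥Λ),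
        ((gaussianFieldOfKernel fun u w => if h : u ∈ Λ ∧ w ∈ Λ then
            ((Matrix.reindex e' e'
              (Matrix.of fun p q : σ × TrIdx N =>
                  trReForm (trBasis N p.2) (((CsDeltaCPY x (lettersYOfRecordV4 N θ Mstar (resYOfC2 N θ Mstar 𝔠) x)
            (sectEYOfRecordV6 N θ Mstar (sectEYWithDt2 N θ Mstar (resYOfC2 N θ Mstar 𝔠) 𝔡₂ 𝔢₀) x) U).restrictScalars ℝ)
                    (Pi.single (ι q.1) (trBasis N q.2)) (ι p.1))))⁻¹ :
                Matrix ↥Λ ↥Λ ℝ) ⟨u, h.1⟩ ⟨w, h.2⟩ else 0).map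
            (fun (z : B1Eq324BenfattoLemma.Site (θ.d₆ + 1 + (θ.d₆ + 1) + 1) → ℝ) (q : σ × TrIdx N) => z ((e' q : ↥Λ) : B1Eq324BenfattoLemma.Site (θ.d₆ + 1 + (θ.d₆ + 1) + 1))) =
          gaussianFieldOfKernel fun p q =>
            ((Matrix.of fun p q : σ × TrIdx N =>
                trReForm (trBasis N p.2) (((CsDeltaCPY x (lettersYOfRecordV4 N θ Mstar (resYOfC2 N θ Mstar 𝔠) x)
            (sectEYOfRecordV6 N θ Mstar (sectEYWithDt2 N θ Mstar (resYOfC2 N θ Mstar 𝔠) 𝔡₂ 𝔢₀) x) U).restrictScalars ℝ)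
                  (Pi.single (ι q.1) (trBasis N q.2)) (ι p.1)))⁻¹ :
              Matrix (σ × TrIdx N) (σ × TrIdx N) ℝ) p q) ∧
        (∀ p : ℝ, 0 ≤ p →
          ((fun (z : B1Eq324BenfattoLemma.Site (θ.d₆ + 1 + (θ.d₆ + 1) + 1) → ℝ) (q : σ × TrIdx N) => z ((e' q : ↥Λ) : B1Eq324BenfattoLemma.Site (θ.d₆ + 1 + (θ.d₆ + 1) + 1))) ⁻¹'
              {ω : σ × TrIdx N → ℝ | ∀ q, |ω q| ≤ p}) =ᵐ[gaussianFieldOfKernel fun u w => if h : u ∈ Λ ∧ w ∈ Λ then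
                ((Matrix.reindex e' e'
                  (Matrix.of fun p q : σ × TrIdx N =>
                      trReForm (trBasis N p.2) (((CsDeltaCPY x (lettersYOfRecordV4 N θ Mstar (resYOfC2 N θ Mstar 𝔠) x)
            (sectEYOfRecordV6 N θ Mstar (sectEYWithDt2 N θ Mstar (resYOfC2 N θ Mstar 𝔠) 𝔡₂ 𝔢₀) x) U).restrictScalars ℝ)
                        (Pi.single (ι q.1) (trBasis N q.2)) (ι p.1))))⁻¹ :
                    Matrix ↥Λ ↥Λ ℝ) ⟨u, h.1⟩ ⟨w, h.2⟩ else 0]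
            smallFieldSet Λ p) ∧
        ∀ (s : ℕ) (I J : Finset (B1Eq324BenfattoLemma.Site (θ.d₆ + 1 + (θ.d₆ + 1) + 1))) (𝔞 : Coef (θ.d₆ + 1 + (θ.d₆ + 1) + 1)),
          I.Nonempty → J ⊆ I → J ⊆ Λ → coefSup s D 𝔞 J ≤ c * η ^ σ' →
          0 < ∫ z, cutoffBoltzmann (hamiltonian s D ϰ 𝔞 J) I (B10.pFun b₀ p₀ η) z ∂(gaussianFieldOfKernel fun u w => if h : u ∈ Λ ∧ w ∈ Λ then
              ((Matrix.reindex e' e'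
                (Matrix.of fun p q : σ × TrIdx N =>
                    trReForm (trBasis N p.2) (((CsDeltaCPY x (lettersYOfRecordV4 N θ Mstar (resYOfC2 N θ Mstar 𝔠) x)
            (sectEYOfRecordV6 N θ Mstar (sectEYWithDt2 N θ Mstar (resYOfC2 N θ Mstar 𝔠) 𝔡₂ 𝔢₀) x) U).restrictScalars ℝ)
                      (Pi.single (ι q.1) (trBasis N q.2)) (ι p.1))))⁻¹ :
                  Matrix ↥Λ ↥Λ ℝ) ⟨u, h.1⟩ ⟨w, h.2⟩ else 0) ∧
            |Real.log (∫ z, cutoffBoltzmann (hamiltonian s D ϰ 𝔞 J) I (B10.pFun b₀ p₀ η) z ∂(gaussianFieldOfKernel fun u w =>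
                if h : u ∈ Λ ∧ w ∈ Λ then
                  ((Matrix.reindex e' e'
                    (Matrix.of fun p q : σ × TrIdx N =>
                        trReForm (trBasis N p.2) (((CsDeltaCPY x (lettersYOfRecordV4 N θ Mstar (resYOfC2 N θ Mstar 𝔠) x)
            (sectEYOfRecordV6 N θ Mstar (sectEYWithDt2 N θ Mstar (resYOfC2 N θ Mstar 𝔠) 𝔡₂ 𝔢₀) x) U).restrictScalars ℝ)
                          (Pi.single (ι q.1) (trBasis N q.2)) (ι p.1))))⁻¹ :
                      Matrix ↥Λ ↥Λ ℝ) ⟨u, h.1⟩ ⟨w, h.2⟩ else 0)) -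
              cumulantSum (gaussianFieldOfKernel fun u w => if h : u ∈ Λ ∧ w ∈ Λ then
                  ((Matrix.reindex e' e'
                    (Matrix.of fun p q : σ × TrIdx N =>
                        trReForm (trBasis N p.2) (((CsDeltaCPY x (lettersYOfRecordV4 N θ Mstar (resYOfC2 N θ Mstar 𝔠) x)
            (sectEYOfRecordV6 N θ Mstar (sectEYWithDt2 N θ Mstar (resYOfC2 N θ Mstar 𝔠) 𝔡₂ 𝔢₀) x) U).restrictScalars ℝ)
                          (Pi.single (ι q.1) (trBasis N q.2)) (ι p.1))))⁻¹ :
                      Matrix ↥Λ ↥Λ ℝ) ⟨u, h.1⟩ ⟨w, h.2⟩ else 0)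
                (hamiltonian s D ϰ 𝔞 J) t| ≤ C * η ^ κ' * I.card := by
  obtain ⟨M₄, δ, a₀, BP, hM₄, hδ, ha₀, hBP, H⟩ := h26
  obtain ⟨b₁, hb₁⟩ := eq324_CsDeltaCPY_opsYOfRecordV8E_trBasis_of_ineq3132_of_JRows_onΛ_on_unit N θ hD Mstar 𝔠 𝔡₂ 𝔢₀ 𝔢 𝔴 𝔈 (r₂ := r₂) hγ₀
    hBP.le hδ ha hMH hj hC₂ hsmall t D hϰ hp₀ hσ hc hκ hκσ
  refine ⟨M₄, δ, a₀, hM₄, hδ, ha₀, b₁, fun b₀ hb₀ => ?_⟩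
  obtain ⟨C, hC, hE⟩ := hb₁ b₀ hb₀
  refine ⟨C, hC, ?_⟩
  intro η hη hηle x _ hMx α₀ hα₀ hMa U h335 h336 hP hCr hDr σ _ _ _ ι hι hιT hH hJ hDloc hDsz hco
  exact hE η hη hηle x specialUnitaryUnits_le_unitaryUnits U (B9BackgroundsKLevelV1.mem_of_reg335 x.toKIdx h335.1) hP hCr hDr ι hι hιT
    (H x hMx α₀ hα₀ hMa U h335 h336).2 hH hJ hDloc hDsz hco

end BothRowsByName

/-! ## §5 (v1.1, APPEND-ONLY; seat dag-n08-b gen 34, CHECK-K ∕ INTENT-12) The 𝒥-row BY NAME ALONG PRINT's (3.136) ROUTE — member-uniform inputs.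
§4's 𝒥-side rows (b) column mass of `H₁` and (d) a FLAT sup `‖J(U)(b)‖ ≤ j` over all fine bonds are correct but (d) is not what (3.36) supplies uniformly in `k`
(node N06's `B9Eq336RegularAtAllBondsP.norm_J_le_of_regYP336`: `∝ (L^{lev}η)⁻³`, i.e. `η⁻³` at level `0`).  Print moves `H₁` onto the current ((3.136), p. 427):
only the adjoint current `H₁(U)†J(U)` on the OUTPUT SUPPORT of `D̃⁽²⁾` (unit blocks, top level) enters, where `|(H₁*J)(z)| = O(Mα₀)` uniformly.  This section
re-issues §4's two theorems with rows (b)(d) REPLACED by (b†) a print-unit sup of `trAdjY (trDualMatY N) (H₁ U) (JY U)` on a FREE support predicate `S` and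
(c-out) the output support of `𝔡₂` inside `S` (composition: seat n08-d's `…JRowCompositionAtNode00.JRowPrint_sectEYWithDt2_of_adjCurrent_onΛ` (v1.1, CHECK-K ∕ INTENT-90), `K_J := θ.b₁ + 2N³·j₁·C₂·e^{δr₂}`). -/

section AdjointCurrentByName

open scoped Matrix.Norms.L2Operator
open B7Prop2Explicit (unitaryUnits)
open B7Prop2SpecialUnitary (specialUnitaryUnits specialUnitaryUnits_le_unitaryUnits)
open B9Thm311ReadingCoords (trIP IsSymmTr)
open B9CoReadingCoordsTranspose (trReForm trReForm_symm sum_trReForm_eq_trIP TrIdx trBasis)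
open B8Lemma1NonAbelian (pairTop)
open B9PinMembersKLevelV1 (geo9Y bg9Y)
open B9Eq3132NuReading (siteKernelOfOpNu nuY opsYNuOfRecordV4E)
open B1Eq324BenfattoClassSectEMemberJRowCompositionAtNode00 (JRowPrint_sectEYWithDt2_of_adjCurrent_onΛ KJadj_nonneg)

/-- ★★★ **THE DOOR WITH BOTH N06-SIDE ROWS BY NAME, PER BACKGROUND, 𝒥-ROW ALONG (3.136)** — §4's first theorem with rows (b)(d) replaced: the door's N06 ∕ [5]
inputs are now (a) node N06's numbered row 26 at `U`, `B9.Ineq3132 (d+1) ((opsYNuOfRecordV4E … (resYOfC2 𝔠) 𝔢 𝔴 𝔈 x).QG1Qinv) B_P δ U`; for a support predicate `S`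
on unit-lattice bonds (the suppliers' choice, e.g. «top-level bond»): (b†) `η^{d+1}·‖(H₁(U)†J(U))(z)‖ ≤ j₁` on `S` (def-Y's flat transpose `trAdjY (trDualMatY N)`;
node N06's (3.136)-type bound for `H₁`, p. 427, member-uniform on top-level bonds); (c-out) for `u, v ∈ Λ` the output `D̃⁽²⁾(U; δ_v ⊗ E, δ_u ⊗ a)` is supported in `S`;
(c) argument-locality radius `r₂` and size `C₂` of [5]'s letter `D̃⁽²⁾(U)`; and `γ₀` (R5′).  `K_J := θ.b₁ + 2N³·j₁·C₂·e^{δr₂}` at the P-row's rate.  Regime rows and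
[5]'s reality as in §1.  Conclusion (3.24) for `𝒩(0, 𝕄_ι(CsDeltaCPY U)⁻¹)`.
[cite: Balaban1985BackgroundPropagators, (3.132) p.422, (3.136) p.422, Thm 3.12 p.423, p.427, (3.117) p.419, (3.156)–(3.158) p.428, Thm 3.11 p.416; Balaban1985Averaging,
(136) p.39; Balaban1984PropagatorsII, (2.149) p.249, (2.16) p.225; Balaban1985UV3, (24) p.262, pp.271–272; Balaban1982Higgs1, (3.24) p.616; BenfattoEtAl1978,
Lemma (4.5)–(4.7) p.152 (class form; bent window, presentation and coordinates ours)] -/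
theorem eq324_CsDeltaCPY_opsYOfRecordV8E_trBasis_of_ineq3132_of_adjCurrent_onΛ_on_unit (N : ℕ) [NeZero N] (θ : Stage3Params) (hD : 2 ≤ θ.d₆ + 1)
    (Mstar : ℕ) (𝔠 : C2Y N θ Mstar) (𝔡₂ : Dt2Y N θ Mstar) (𝔢₀ 𝔢 : SectEY N θ Mstar) (𝔴 : RWEY N θ Mstar) (𝔈 : ExpsY N θ Mstar) {γ₀ BP δ a j₁ C₂ r₂ : ℝ}
    (hγ₀ : 0 < γ₀) (hBP : 0 ≤ BP) (hδ : 0 < δ) (ha : 0 ≤ a) (hj₁ : 0 ≤ j₁) (hC₂ : 0 ≤ C₂) (hsmall : (((θ.ℓ₆ + 1 : ℕ) : ℝ)) ^ (θ.d₆ + 1) *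
      (2 * ((((θ.d₆ * (2 * θ.ℓ₆ + 1) : ℕ) : ℝ)) * a) * (((θ.ℓ₆ + 1 : ℕ) + (θ.d₆ + 1) * θ.ℓ₆ : ℕ) : ℝ)) < 1)
    (t D : ℕ) {ϰ : ℝ} (hϰ : 0 < ϰ)
    {p₀ σ' c κ' : ℝ} (hp₀ : 2 / 3 < p₀) (hσ : 0 < σ') (hc : 0 ≤ c) (hκ : 0 < κ') (hκσ : κ' < σ' * (t + 1)) :
    ∃ b₁ : ℝ, ∀ b₀ : ℝ, b₁ < b₀ → ∃ C : ℝ, 0 ≤ C ∧ ∀ η : ℝ, 0 < η → η ≤ 1 →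
      ∀ (x : MemberY θ.d₆ θ.ℓ₆ θ.hd' θ.hL' θ.b₀ θ.b₁ Mstar) [DecidableEq (IBondY x.toKIdx)]
        {G : Subgroup (Matrix (Fin N) (Fin N) ℂ)ˣ}, G ≤ unitaryUnits (Matrix (Fin N) (Fin N) ℂ) →
      ∀ (U : CfgY (Matrix (Fin N) (Fin N) ℂ) x.toKIdx), (∀ μ z, U μ z ∈ G) →
        (∀ c' : CBondY x, B8Lemma1NonAbelian.PlaqSmall (VzY x (avYOfRecord x U)) (labK x c'.1.1) (labK x c'.1.1 + pairTop (θ.ℓ₆ + 1) c'.1.2) a) →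
        (∀ A A' : FBondY x.toKIdx → Matrix (Fin N) (Fin N) ℂ, (𝔠 x).form U (star A) (star A') = star ((𝔠 x).form U A A')) →
        (∀ B B' : IBondY x.toKIdx → Matrix (Fin N) (Fin N) ℂ, (𝔡₂ x).form U (star B) (star B') = star ((𝔡₂ x).form U B B')) →
      ∀ {σ : Type} [Fintype σ] [DecidableEq σ] [Nonempty σ] (ι : σ → IBondY x.toKIdx), Function.Injective ι → (∀ s, lamTY x (ι s)) →
        B9.Ineq3132 (θ.d₆ + 1) (opsYNuOfRecordV4E N θ Mstar (resYOfC2 N θ Mstar 𝔠) 𝔢 𝔴 𝔈 x).QG1Qinv BP δ U →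
      ∀ (S : IBondY x.toKIdx → Prop),
        (∀ z, S z → etaDY x * ‖trAdjY (trDualMatY N) ((lettersYOfRecordV4 N θ Mstar (resYOfC2 N θ Mstar 𝔠) x).H₁ U) (JY x.toKIdx U) z‖ ≤ j₁) →
        (∀ (u v : IBondY x.toKIdx) (E a : Matrix (Fin N) (Fin N) ℂ) (z : IBondY x.toKIdx), inΛY x u → inΛY x v →
          (𝔡₂ x).form U (Pi.single v E) (Pi.single u a) z ≠ 0 → S z) →
        (∀ (u v : IBondY x.toKIdx) (E a : Matrix (Fin N) (Fin N) ℂ), r₂ < unitDistY x u v → (𝔡₂ x).form U (Pi.single v E) (Pi.single u a) = 0) →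
        (∀ (u v : IBondY x.toKIdx) (E a : Matrix (Fin N) (Fin N) ℂ), ∑ z, ‖(𝔡₂ x).form U (Pi.single v E) (Pi.single u a) z‖ ≤ C₂ * ‖E‖ * ‖a‖) →
        (∀ Φ : IBondY x.toKIdx → Matrix (Fin N) (Fin N) ℂ, (∀ u, u ∉ Set.range ι → Φ u = 0) →
          γ₀ * trIP (fun _ => (1 : ℝ)) Φ Φ ≤ trIP (fun _ => (1 : ℝ)) Φ ((CsDeltaCPY x (lettersYOfRecordV4 N θ Mstar (resYOfC2 N θ Mstar 𝔠) x)
            (sectEYOfRecordV6 N θ Mstar (sectEYWithDt2 N θ Mstar (resYOfC2 N θ Mstar 𝔠) 𝔡₂ 𝔢₀) x) U) Φ)) →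
      ∃ (Λ : Finset (B1Eq324BenfattoLemma.Site (θ.d₆ + 1 + (θ.d₆ + 1) + 1))) (e' : σ × TrIdx N ≃ ↥Λ),
        ((gaussianFieldOfKernel fun u w => if h : u ∈ Λ ∧ w ∈ Λ then
            ((Matrix.reindex e' e'
              (Matrix.of fun p q : σ × TrIdx N =>
                  trReForm (trBasis N p.2) (((CsDeltaCPY x (lettersYOfRecordV4 N θ Mstar (resYOfC2 N θ Mstar 𝔠) x)
            (sectEYOfRecordV6 N θ Mstar (sectEYWithDt2 N θ Mstar (resYOfC2 N θ Mstar 𝔠) 𝔡₂ 𝔢₀) x) U).restrictScalars ℝ)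
                    (Pi.single (ι q.1) (trBasis N q.2)) (ι p.1))))⁻¹ :
                Matrix ↥Λ ↥Λ ℝ) ⟨u, h.1⟩ ⟨w, h.2⟩ else 0).map
            (fun (z : B1Eq324BenfattoLemma.Site (θ.d₆ + 1 + (θ.d₆ + 1) + 1) → ℝ) (q : σ × TrIdx N) => z ((e' q : ↥Λ) : B1Eq324BenfattoLemma.Site (θ.d₆ + 1 + (θ.d₆ + 1) + 1))) =
          gaussianFieldOfKernel fun p q =>
            ((Matrix.of fun p q : σ × TrIdx N =>
                trReForm (trBasis N p.2) (((CsDeltaCPY x (lettersYOfRecordV4 N θ Mstar (resYOfC2 N θ Mstar 𝔠) x)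
            (sectEYOfRecordV6 N θ Mstar (sectEYWithDt2 N θ Mstar (resYOfC2 N θ Mstar 𝔠) 𝔡₂ 𝔢₀) x) U).restrictScalars ℝ)
                  (Pi.single (ι q.1) (trBasis N q.2)) (ι p.1)))⁻¹ :
              Matrix (σ × TrIdx N) (σ × TrIdx N) ℝ) p q) ∧
        (∀ p : ℝ, 0 ≤ p →
          ((fun (z : B1Eq324BenfattoLemma.Site (θ.d₆ + 1 + (θ.d₆ + 1) + 1) → ℝ) (q : σ × TrIdx N) => z ((e' q : ↥Λ) : B1Eq324BenfattoLemma.Site (θ.d₆ + 1 + (θ.d₆ + 1) + 1))) ⁻¹'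
              {ω : σ × TrIdx N → ℝ | ∀ q, |ω q| ≤ p}) =ᵐ[gaussianFieldOfKernel fun u w => if h : u ∈ Λ ∧ w ∈ Λ then
                ((Matrix.reindex e' e'
                  (Matrix.of fun p q : σ × TrIdx N =>
                      trReForm (trBasis N p.2) (((CsDeltaCPY x (lettersYOfRecordV4 N θ Mstar (resYOfC2 N θ Mstar 𝔠) x)
            (sectEYOfRecordV6 N θ Mstar (sectEYWithDt2 N θ Mstar (resYOfC2 N θ Mstar 𝔠) 𝔡₂ 𝔢₀) x) U).restrictScalars ℝ)
                        (Pi.single (ι q.1) (trBasis N q.2)) (ι p.1))))⁻¹ :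
                    Matrix ↥Λ ↥Λ ℝ) ⟨u, h.1⟩ ⟨w, h.2⟩ else 0]
            smallFieldSet Λ p) ∧
        ∀ (s : ℕ) (I J : Finset (B1Eq324BenfattoLemma.Site (θ.d₆ + 1 + (θ.d₆ + 1) + 1))) (𝔞 : Coef (θ.d₆ + 1 + (θ.d₆ + 1) + 1)),
          I.Nonempty → J ⊆ I → J ⊆ Λ → coefSup s D 𝔞 J ≤ c * η ^ σ' →
          0 < ∫ z, cutoffBoltzmann (hamiltonian s D ϰ 𝔞 J) I (B10.pFun b₀ p₀ η) z ∂(gaussianFieldOfKernel fun u w => if h : u ∈ Λ ∧ w ∈ Λ then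
              ((Matrix.reindex e' e'
                (Matrix.of fun p q : σ × TrIdx N =>
                    trReForm (trBasis N p.2) (((CsDeltaCPY x (lettersYOfRecordV4 N θ Mstar (resYOfC2 N θ Mstar 𝔠) x)
            (sectEYOfRecordV6 N θ Mstar (sectEYWithDt2 N θ Mstar (resYOfC2 N θ Mstar 𝔠) 𝔡₂ 𝔢₀) x) U).restrictScalars ℝ)
                      (Pi.single (ι q.1) (trBasis N q.2)) (ι p.1))))⁻¹ :
                  Matrix ↥Λ ↥Λ ℝ) ⟨u, h.1⟩ ⟨w, h.2⟩ else 0) ∧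
            |Real.log (∫ z, cutoffBoltzmann (hamiltonian s D ϰ 𝔞 J) I (B10.pFun b₀ p₀ η) z ∂(gaussianFieldOfKernel fun u w =>
                if h : u ∈ Λ ∧ w ∈ Λ then
                  ((Matrix.reindex e' e'
                    (Matrix.of fun p q : σ × TrIdx N =>
                        trReForm (trBasis N p.2) (((CsDeltaCPY x (lettersYOfRecordV4 N θ Mstar (resYOfC2 N θ Mstar 𝔠) x)
            (sectEYOfRecordV6 N θ Mstar (sectEYWithDt2 N θ Mstar (resYOfC2 N θ Mstar 𝔠) 𝔡₂ 𝔢₀) x) U).restrictScalars ℝ)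
                          (Pi.single (ι q.1) (trBasis N q.2)) (ι p.1))))⁻¹ :
                      Matrix ↥Λ ↥Λ ℝ) ⟨u, h.1⟩ ⟨w, h.2⟩ else 0)) -
              cumulantSum (gaussianFieldOfKernel fun u w => if h : u ∈ Λ ∧ w ∈ Λ then
                  ((Matrix.reindex e' e'
                    (Matrix.of fun p q : σ × TrIdx N =>
                        trReForm (trBasis N p.2) (((CsDeltaCPY x (lettersYOfRecordV4 N θ Mstar (resYOfC2 N θ Mstar 𝔠) x)
            (sectEYOfRecordV6 N θ Mstar (sectEYWithDt2 N θ Mstar (resYOfC2 N θ Mstar 𝔠) 𝔡₂ 𝔢₀) x) U).restrictScalars ℝ)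
                          (Pi.single (ι q.1) (trBasis N q.2)) (ι p.1))))⁻¹ :
                      Matrix ↥Λ ↥Λ ℝ) ⟨u, h.1⟩ ⟨w, h.2⟩ else 0)
                (hamiltonian s D ϰ 𝔞 J) t| ≤ C * η ^ κ' * I.card := by
  obtain ⟨b₁, hb₁⟩ := eq324_CsDeltaCPY_opsYOfRecordV8E_trBasis_of_ineq3132_onΛ_on_unit N θ Mstar 𝔠 𝔡₂ 𝔢₀ 𝔢 𝔴 𝔈 hγ₀ hBP
    (KJadj_nonneg (N := N) (r₂ := r₂) (δ := δ) θ hj₁ hC₂) hδ ha hsmall t D hϰ hp₀ hσ hc hκ hκσ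
  refine ⟨b₁, fun b₀ hb₀ => ?_⟩
  obtain ⟨C, hC, hE⟩ := hb₁ b₀ hb₀
  refine ⟨C, hC, ?_⟩
  intro η hη hηle x _ G hG U hU hP hCr hDr σ _ _ _ ι hι hιT h3132 S hHJ hDsupp hDloc hDsz hco
  exact hE η hη hηle x hG U hU hP hCr hDr ι hι hιT h3132
    (JRowPrint_sectEYWithDt2_of_adjCurrent_onΛ θ Mstar (resYOfC2 N θ Mstar 𝔠) 𝔡₂ 𝔢₀ hD x U S hj₁ hC₂ hδ.le hHJ hDsupp hDloc hDsz) hco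

/-- ★★★ **THE FAMILY FORM OVER NODE N06's ROW 26, 𝒥-ROW ALONG (3.136)** — §4's second theorem with rows (b)(d) replaced by (b†)(c-out): hypothesis = the conclusion TYPE
of n06-i's `s3132Nu_opsYNuOfRecordV4E` (`B9.Stmt3132Printed …`) verbatim; thresholds `M₄`, `a₀` and ONE rate `δ₁` for the whole Stage-3′ family; regime by print's
(3.35)–(3.36) classes of `bg9Y SU(N)` (`U` is `SU(N)`-valued, `mem_of_reg335`).  DISPLAYED: plaquette smallness of the averaged field of record, [5]'s reality of
`C⁽²⁾(U)`, `D̃⁽²⁾(U)`, (b†) the print-unit sup of `H₁(U)†J(U)` on a support predicate `S`, (c-out)(c) the output support ∕ argument locality ∕ size of `D̃⁽²⁾`, `γ₀` (R5′) —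
every one of them member-uniform in print.
[cite: Balaban1985BackgroundPropagators, (3.132) p.422, (3.136) p.422, Thm 3.12 p.423, (3.35)–(3.36) p.396, p.427, (3.117) p.419, (3.156)–(3.158) p.428; Balaban1985Averaging,
(136) p.39; Balaban1984PropagatorsII, (2.149) p.249; Balaban1985UV3, (24) p.262, pp.271–272; Balaban1982Higgs1, (3.24) p.616; BenfattoEtAl1978, Lemma (4.5)–(4.7) p.152
(class form; bent window, presentation and coordinates ours)] -/
theorem eq324_CsDeltaCPY_opsYOfRecordV8E_trBasis_of_stmt3132Printed_of_adjCurrent_onΛ_on_unit (N : ℕ) [NeZero N] (θ : Stage3Params) (hD : 2 ≤ θ.d₆ + 1)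
    (Mstar : ℕ) (𝔠 : C2Y N θ Mstar) (𝔡₂ : Dt2Y N θ Mstar) (𝔢₀ 𝔢 : SectEY N θ Mstar) (𝔴 : RWEY N θ Mstar) (𝔈 : ExpsY N θ Mstar) {c35 : ℝ}
    (h26 : B9.Stmt3132Printed (θ.d₆ + 1) c35
      (geo9Y (d := θ.d₆) (ℓ := θ.ℓ₆) (hd := θ.hd') (hL := θ.hL') (b₀ := θ.b₀) (b₁ := θ.b₁) (Mstar := Mstar))
      (bg9Y (Matrix (Fin N) (Fin N) ℂ) (specialUnitaryUnits (Fin N)))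
      (fun x => (opsYNuOfRecordV4E N θ Mstar (resYOfC2 N θ Mstar 𝔠) 𝔢 𝔴 𝔈 x).QGQinv)
      (fun x => (opsYNuOfRecordV4E N θ Mstar (resYOfC2 N θ Mstar 𝔠) 𝔢 𝔴 𝔈 x).QG1Qinv))
    {γ₀ a j₁ C₂ r₂ : ℝ} (hγ₀ : 0 < γ₀) (ha : 0 ≤ a) (hj₁ : 0 ≤ j₁) (hC₂ : 0 ≤ C₂) (hsmall : (((θ.ℓ₆ + 1 : ℕ) : ℝ)) ^ (θ.d₆ + 1) *
      (2 * ((((θ.d₆ * (2 * θ.ℓ₆ + 1) : ℕ) : ℝ)) * a) * (((θ.ℓ₆ + 1 : ℕ) + (θ.d₆ + 1) * θ.ℓ₆ : ℕ) : ℝ)) < 1)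
    (t D : ℕ) {ϰ : ℝ} (hϰ : 0 < ϰ)
    {p₀ σ' c κ' : ℝ} (hp₀ : 2 / 3 < p₀) (hσ : 0 < σ') (hc : 0 ≤ c) (hκ : 0 < κ') (hκσ : κ' < σ' * (t + 1)) :
    ∃ M₄ δ a₀ : ℝ, 0 < M₄ ∧ 0 < δ ∧ 0 < a₀ ∧ ∃ b₁ : ℝ, ∀ b₀ : ℝ, b₁ < b₀ → ∃ C : ℝ, 0 ≤ C ∧ ∀ η : ℝ, 0 < η → η ≤ 1 →
      ∀ (x : MemberY θ.d₆ θ.ℓ₆ θ.hd' θ.hL' θ.b₀ θ.b₁ Mstar) [DecidableEq (IBondY x.toKIdx)], M₄ ≤ (geo9Y x).M →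
      ∀ α₀ : ℝ, 0 < α₀ → (geo9Y x).M * α₀ ≤ a₀ →
      ∀ (U : CfgY (Matrix (Fin N) (Fin N) ℂ) x.toKIdx),
        (bg9Y (Matrix (Fin N) (Fin N) ℂ) (specialUnitaryUnits (Fin N)) x).Reg335 c35 α₀ U →
        (bg9Y (Matrix (Fin N) (Fin N) ℂ) (specialUnitaryUnits (Fin N)) x).Reg336 c35 α₀ U →
        (∀ c' : CBondY x, B8Lemma1NonAbelian.PlaqSmall (VzY x (avYOfRecord x U)) (labK x c'.1.1) (labK x c'.1.1 + pairTop (θ.ℓ₆ + 1) c'.1.2) a) →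
        (∀ A A' : FBondY x.toKIdx → Matrix (Fin N) (Fin N) ℂ, (𝔠 x).form U (star A) (star A') = star ((𝔠 x).form U A A')) →
        (∀ B B' : IBondY x.toKIdx → Matrix (Fin N) (Fin N) ℂ, (𝔡₂ x).form U (star B) (star B') = star ((𝔡₂ x).form U B B')) →
      ∀ {σ : Type} [Fintype σ] [DecidableEq σ] [Nonempty σ] (ι : σ → IBondY x.toKIdx), Function.Injective ι → (∀ s, lamTY x (ι s)) →
      ∀ (S : IBondY x.toKIdx → Prop),
        (∀ z, S z → etaDY x * ‖trAdjY (trDualMatY N) ((lettersYOfRecordV4 N θ Mstar (resYOfC2 N θ Mstar 𝔠) x).H₁ U) (JY x.toKIdx U) z‖ ≤ j₁) →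
        (∀ (u v : IBondY x.toKIdx) (E a : Matrix (Fin N) (Fin N) ℂ) (z : IBondY x.toKIdx), inΛY x u → inΛY x v →
          (𝔡₂ x).form U (Pi.single v E) (Pi.single u a) z ≠ 0 → S z) →
        (∀ (u v : IBondY x.toKIdx) (E a : Matrix (Fin N) (Fin N) ℂ), r₂ < unitDistY x u v → (𝔡₂ x).form U (Pi.single v E) (Pi.single u a) = 0) →
        (∀ (u v : IBondY x.toKIdx) (E a : Matrix (Fin N) (Fin N) ℂ), ∑ z, ‖(𝔡₂ x).form U (Pi.single v E) (Pi.single u a) z‖ ≤ C₂ * ‖E‖ * ‖a‖) →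
        (∀ Φ : IBondY x.toKIdx → Matrix (Fin N) (Fin N) ℂ, (∀ u, u ∉ Set.range ι → Φ u = 0) →
          γ₀ * trIP (fun _ => (1 : ℝ)) Φ Φ ≤ trIP (fun _ => (1 : ℝ)) Φ ((CsDeltaCPY x (lettersYOfRecordV4 N θ Mstar (resYOfC2 N θ Mstar 𝔠) x)
            (sectEYOfRecordV6 N θ Mstar (sectEYWithDt2 N θ Mstar (resYOfC2 N θ Mstar 𝔠) 𝔡₂ 𝔢₀) x) U) Φ)) →
      ∃ (Λ : Finset (B1Eq324BenfattoLemma.Site (θ.d₆ + 1 + (θ.d₆ + 1) + 1))) (e' : σ × TrIdx N ≃ ↥Λ),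
        ((gaussianFieldOfKernel fun u w => if h : u ∈ Λ ∧ w ∈ Λ then
            ((Matrix.reindex e' e'
              (Matrix.of fun p q : σ × TrIdx N =>
                  trReForm (trBasis N p.2) (((CsDeltaCPY x (lettersYOfRecordV4 N θ Mstar (resYOfC2 N θ Mstar 𝔠) x)
            (sectEYOfRecordV6 N θ Mstar (sectEYWithDt2 N θ Mstar (resYOfC2 N θ Mstar 𝔠) 𝔡₂ 𝔢₀) x) U).restrictScalars ℝ)
                    (Pi.single (ι q.1) (trBasis N q.2)) (ι p.1))))⁻¹ :
                Matrix ↥Λ ↥Λ ℝ) ⟨u, h.1⟩ ⟨w, h.2⟩ else 0).map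
            (fun (z : B1Eq324BenfattoLemma.Site (θ.d₆ + 1 + (θ.d₆ + 1) + 1) → ℝ) (q : σ × TrIdx N) => z ((e' q : ↥Λ) : B1Eq324BenfattoLemma.Site (θ.d₆ + 1 + (θ.d₆ + 1) + 1))) =
          gaussianFieldOfKernel fun p q =>
            ((Matrix.of fun p q : σ × TrIdx N =>
                trReForm (trBasis N p.2) (((CsDeltaCPY x (lettersYOfRecordV4 N θ Mstar (resYOfC2 N θ Mstar 𝔠) x)
            (sectEYOfRecordV6 N θ Mstar (sectEYWithDt2 N θ Mstar (resYOfC2 N θ Mstar 𝔠) 𝔡₂ 𝔢₀) x) U).restrictScalars ℝ)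
                  (Pi.single (ι q.1) (trBasis N q.2)) (ι p.1)))⁻¹ :
              Matrix (σ × TrIdx N) (σ × TrIdx N) ℝ) p q) ∧
        (∀ p : ℝ, 0 ≤ p →
          ((fun (z : B1Eq324BenfattoLemma.Site (θ.d₆ + 1 + (θ.d₆ + 1) + 1) → ℝ) (q : σ × TrIdx N) => z ((e' q : ↥Λ) : B1Eq324BenfattoLemma.Site (θ.d₆ + 1 + (θ.d₆ + 1) + 1))) ⁻¹'
              {ω : σ × TrIdx N → ℝ | ∀ q, |ω q| ≤ p}) =ᵐ[gaussianFieldOfKernel fun u w => if h : u ∈ Λ ∧ w ∈ Λ then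
                ((Matrix.reindex e' e'
                  (Matrix.of fun p q : σ × TrIdx N =>
                      trReForm (trBasis N p.2) (((CsDeltaCPY x (lettersYOfRecordV4 N θ Mstar (resYOfC2 N θ Mstar 𝔠) x)
            (sectEYOfRecordV6 N θ Mstar (sectEYWithDt2 N θ Mstar (resYOfC2 N θ Mstar 𝔠) 𝔡₂ 𝔢₀) x) U).restrictScalars ℝ)
                        (Pi.single (ι q.1) (trBasis N q.2)) (ι p.1))))⁻¹ :
                    Matrix ↥Λ ↥Λ ℝ) ⟨u, h.1⟩ ⟨w, h.2⟩ else 0]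
            smallFieldSet Λ p) ∧
        ∀ (s : ℕ) (I J : Finset (B1Eq324BenfattoLemma.Site (θ.d₆ + 1 + (θ.d₆ + 1) + 1))) (𝔞 : Coef (θ.d₆ + 1 + (θ.d₆ + 1) + 1)),
          I.Nonempty → J ⊆ I → J ⊆ Λ → coefSup s D 𝔞 J ≤ c * η ^ σ' →
          0 < ∫ z, cutoffBoltzmann (hamiltonian s D ϰ 𝔞 J) I (B10.pFun b₀ p₀ η) z ∂(gaussianFieldOfKernel fun u w => if h : u ∈ Λ ∧ w ∈ Λ then
              ((Matrix.reindex e' e'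
                (Matrix.of fun p q : σ × TrIdx N =>
                    trReForm (trBasis N p.2) (((CsDeltaCPY x (lettersYOfRecordV4 N θ Mstar (resYOfC2 N θ Mstar 𝔠) x)
            (sectEYOfRecordV6 N θ Mstar (sectEYWithDt2 N θ Mstar (resYOfC2 N θ Mstar 𝔠) 𝔡₂ 𝔢₀) x) U).restrictScalars ℝ)
                      (Pi.single (ι q.1) (trBasis N q.2)) (ι p.1))))⁻¹ :
                  Matrix ↥Λ ↥Λ ℝ) ⟨u, h.1⟩ ⟨w, h.2⟩ else 0) ∧
            |Real.log (∫ z, cutoffBoltzmann (hamiltonian s D ϰ 𝔞 J) I (B10.pFun b₀ p₀ η) z ∂(gaussianFieldOfKernel fun u w =>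
                if h : u ∈ Λ ∧ w ∈ Λ then
                  ((Matrix.reindex e' e'
                    (Matrix.of fun p q : σ × TrIdx N =>
                        trReForm (trBasis N p.2) (((CsDeltaCPY x (lettersYOfRecordV4 N θ Mstar (resYOfC2 N θ Mstar 𝔠) x)
            (sectEYOfRecordV6 N θ Mstar (sectEYWithDt2 N θ Mstar (resYOfC2 N θ Mstar 𝔠) 𝔡₂ 𝔢₀) x) U).restrictScalars ℝ)
                          (Pi.single (ι q.1) (trBasis N q.2)) (ι p.1))))⁻¹ :
                      Matrix ↥Λ ↥Λ ℝ) ⟨u, h.1⟩ ⟨w, h.2⟩ else 0)) -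
              cumulantSum (gaussianFieldOfKernel fun u w => if h : u ∈ Λ ∧ w ∈ Λ then
                  ((Matrix.reindex e' e'
                    (Matrix.of fun p q : σ × TrIdx N =>
                        trReForm (trBasis N p.2) (((CsDeltaCPY x (lettersYOfRecordV4 N θ Mstar (resYOfC2 N θ Mstar 𝔠) x)
            (sectEYOfRecordV6 N θ Mstar (sectEYWithDt2 N θ Mstar (resYOfC2 N θ Mstar 𝔠) 𝔡₂ 𝔢₀) x) U).restrictScalars ℝ)
                          (Pi.single (ι q.1) (trBasis N q.2)) (ι p.1))))⁻¹ :
                      Matrix ↥Λ ↥Λ ℝ) ⟨u, h.1⟩ ⟨w, h.2⟩ else 0)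
                (hamiltonian s D ϰ 𝔞 J) t| ≤ C * η ^ κ' * I.card := by
  obtain ⟨M₄, δ, a₀, BP, hM₄, hδ, ha₀, hBP, H⟩ := h26
  obtain ⟨b₁, hb₁⟩ := eq324_CsDeltaCPY_opsYOfRecordV8E_trBasis_of_ineq3132_of_adjCurrent_onΛ_on_unit N θ hD Mstar 𝔠 𝔡₂ 𝔢₀ 𝔢 𝔴 𝔈 (r₂ := r₂)
    hγ₀ hBP.le hδ ha hj₁ hC₂ hsmall t D hϰ hp₀ hσ hc hκ hκσ
  refine ⟨M₄, δ, a₀, hM₄, hδ, ha₀, b₁, fun b₀ hb₀ => ?_⟩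
  obtain ⟨C, hC, hE⟩ := hb₁ b₀ hb₀
  refine ⟨C, hC, ?_⟩
  intro η hη hηle x _ hMx α₀ hα₀ hMa U h335 h336 hP hCr hDr σ _ _ _ ι hι hιT S hHJ hDsupp hDloc hDsz hco
  exact hE η hη hηle x specialUnitaryUnits_le_unitaryUnits U (B9BackgroundsKLevelV1.mem_of_reg335 x.toKIdx h335.1) hP hCr hDr ι hι hιT
    (H x hMx α₀ hα₀ hMa U h335 h336).2 S hHJ hDsupp hDloc hDsz hco

end AdjointCurrentByName

/-! ## §6 (v1.2, APPEND-ONLY; seat dag-n08-b gen 34, INTENT-14) The family form AT def-Y's CLASS-PARAMETRIC CARRIER `bg9YR R₁ R₂` (CASCADE-R): hypothesis = the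
edition-8 row-26 face type of n06-i's `B9Eq3132NuReadingR.s3132Nu_opsYNuOfRecordV4E_R`; at `(regY335, regY336)` it is §5's family form (`bg9Y_eq_bg9YR`, rfl), at
`(regYP335, regYP336)` the door at PRINT's class of record `bg9YP` (node00-def-Y RULING-W′) — one theorem for both classes and any later class amendment -/

section ClassParametric

open scoped Matrix.Norms.L2Operator
open B7Prop2Explicit (unitaryUnits)
open B7Prop2SpecialUnitary (specialUnitaryUnits specialUnitaryUnits_le_unitaryUnits)
open B9Thm311ReadingCoords (trIP IsSymmTr)
open B9CoReadingCoordsTranspose (trReForm trReForm_symm sum_trReForm_eq_trIP TrIdx trBasis)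
open B8Lemma1NonAbelian (pairTop)
open B9PinMembersKLevelV1 (geo9Y bg9Y)
open B9Eq3132NuReading (siteKernelOfOpNu nuY opsYNuOfRecordV4E)
open B9BackgroundsKLevelV1R (RegFamY bg9YR MemOfFam siteKernelR mem_of_reg335R)
open B1Eq324BenfattoClassSectEMemberJRowCompositionAtNode00 (JRowPrint_sectEYWithDt2_of_adjCurrent_onΛ KJadj_nonneg)

/-- ★★★ **THE FAMILY-FORM DOOR AT THE CLASS-PARAMETRIC CARRIER** — for ANY pair of regularity families `(R₁, R₂)` on the members (def-Y's `RegFamY`; the classes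
(3.35)–(3.36) as PARAMETERS, CASCADE-R) whose first class is `SU(N)`-valued (`MemOfFam`): if node N06's row 26 holds at the carrier `bg9YR M_N(ℂ) SU(N) R₁ R₂` for the
`ν`-read record over `resYOfC2 𝔠` — the conclusion type of n06-i's `s3132Nu_opsYNuOfRecordV4E_R R₁ R₂`, kernels re-typed by def-Y's `siteKernelR R₁ R₂` (same `.ker`) —
then there are print's thresholds `M₄`, `a₀` and ONE rate `δ₁` such that for every member above `M₄`, every `α₀` with `Mα₀ ≤ a₀` and every background in the two classes
`R₁ x c35 α₀`, `R₂ x c35 α₀`, the (3.24) door of §5 holds: displayed = plaquette smallness of the averaged field of record (print's small-curvature numeral), [5]'s reality of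
`C⁽²⁾(U)`, `D̃⁽²⁾(U)`, (b†) the print-unit sup of the adjoint current `H₁(U)†J(U)` on a support predicate `S`, (c-out)(c) output support ∕ argument locality ∕ size of `D̃⁽²⁾`,
`γ₀` (R5′).  At `(regY335, regY336)` this IS §5's `…_of_stmt3132Printed_of_adjCurrent_onΛ_on_unit` (`bg9Y_eq_bg9YR`, rfl); at `(regYP335, regYP336)` it is the door at
print's class `bg9YP` (`bg9YP_eq_bg9YR`, rfl).
[cite: Balaban1985BackgroundPropagators, (3.132) p.422, (3.136) p.422, Thm 3.12 p.423, (3.35)–(3.36) p.396, p.427, (3.117) p.419, (3.156)–(3.158) p.428; Balaban1985Averaging,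
(136) p.39; Balaban1984PropagatorsII, (2.149) p.249; Balaban1985UV3, (24) p.262, pp.271–272; Balaban1982Higgs1, (3.24) p.616; BenfattoEtAl1978, Lemma (4.5)–(4.7) p.152
(class form; bent window, presentation and coordinates ours)] -/
theorem eq324_CsDeltaCPY_opsYOfRecordV8E_trBasis_of_stmt3132Printed_R_of_adjCurrent_onΛ_on_unit (N : ℕ) [NeZero N] (θ : Stage3Params) (hD : 2 ≤ θ.d₆ + 1)
    (Mstar : ℕ) (𝔠 : C2Y N θ Mstar) (𝔡₂ : Dt2Y N θ Mstar) (𝔢₀ 𝔢 : SectEY N θ Mstar) (𝔴 : RWEY N θ Mstar) (𝔈 : ExpsY N θ Mstar)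
    (R₁ R₂ : RegFamY θ.d₆ θ.ℓ₆ θ.hd' θ.hL' θ.b₀ θ.b₁ Mstar (Matrix (Fin N) (Fin N) ℂ)) (hR : MemOfFam (specialUnitaryUnits (Fin N)) R₁) {c35 : ℝ}
    (h26 : B9.Stmt3132Printed (θ.d₆ + 1) c35
      (geo9Y (d := θ.d₆) (ℓ := θ.ℓ₆) (hd := θ.hd') (hL := θ.hL') (b₀ := θ.b₀) (b₁ := θ.b₁) (Mstar := Mstar))
      (bg9YR (Matrix (Fin N) (Fin N) ℂ) (specialUnitaryUnits (Fin N)) R₁ R₂)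
      (fun x => siteKernelR R₁ R₂ (opsYNuOfRecordV4E N θ Mstar (resYOfC2 N θ Mstar 𝔠) 𝔢 𝔴 𝔈 x).QGQinv)
      (fun x => siteKernelR R₁ R₂ (opsYNuOfRecordV4E N θ Mstar (resYOfC2 N θ Mstar 𝔠) 𝔢 𝔴 𝔈 x).QG1Qinv))
    {γ₀ a j₁ C₂ r₂ : ℝ} (hγ₀ : 0 < γ₀) (ha : 0 ≤ a) (hj₁ : 0 ≤ j₁) (hC₂ : 0 ≤ C₂) (hsmall : (((θ.ℓ₆ + 1 : ℕ) : ℝ)) ^ (θ.d₆ + 1) *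
      (2 * ((((θ.d₆ * (2 * θ.ℓ₆ + 1) : ℕ) : ℝ)) * a) * (((θ.ℓ₆ + 1 : ℕ) + (θ.d₆ + 1) * θ.ℓ₆ : ℕ) : ℝ)) < 1)
    (t D : ℕ) {ϰ : ℝ} (hϰ : 0 < ϰ)
    {p₀ σ' c κ' : ℝ} (hp₀ : 2 / 3 < p₀) (hσ : 0 < σ') (hc : 0 ≤ c) (hκ : 0 < κ') (hκσ : κ' < σ' * (t + 1)) :
    ∃ M₄ δ a₀ : ℝ, 0 < M₄ ∧ 0 < δ ∧ 0 < a₀ ∧ ∃ b₁ : ℝ, ∀ b₀ : ℝ, b₁ < b₀ → ∃ C : ℝ, 0 ≤ C ∧ ∀ η : ℝ, 0 < η → η ≤ 1 →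
      ∀ (x : MemberY θ.d₆ θ.ℓ₆ θ.hd' θ.hL' θ.b₀ θ.b₁ Mstar) [DecidableEq (IBondY x.toKIdx)], M₄ ≤ (geo9Y x).M →
      ∀ α₀ : ℝ, 0 < α₀ → (geo9Y x).M * α₀ ≤ a₀ →
      ∀ (U : CfgY (Matrix (Fin N) (Fin N) ℂ) x.toKIdx), R₁ x c35 α₀ U → R₂ x c35 α₀ U →
        (∀ c' : CBondY x, B8Lemma1NonAbelian.PlaqSmall (VzY x (avYOfRecord x U)) (labK x c'.1.1) (labK x c'.1.1 + pairTop (θ.ℓ₆ + 1) c'.1.2) a) →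
        (∀ A A' : FBondY x.toKIdx → Matrix (Fin N) (Fin N) ℂ, (𝔠 x).form U (star A) (star A') = star ((𝔠 x).form U A A')) →
        (∀ B B' : IBondY x.toKIdx → Matrix (Fin N) (Fin N) ℂ, (𝔡₂ x).form U (star B) (star B') = star ((𝔡₂ x).form U B B')) →
      ∀ {σ : Type} [Fintype σ] [DecidableEq σ] [Nonempty σ] (ι : σ → IBondY x.toKIdx), Function.Injective ι → (∀ s, lamTY x (ι s)) →
      ∀ (S : IBondY x.toKIdx → Prop),
        (∀ z, S z → etaDY x * ‖trAdjY (trDualMatY N) ((lettersYOfRecordV4 N θ Mstar (resYOfC2 N θ Mstar 𝔠) x).H₁ U) (JY x.toKIdx U) z‖ ≤ j₁) →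
        (∀ (u v : IBondY x.toKIdx) (E a : Matrix (Fin N) (Fin N) ℂ) (z : IBondY x.toKIdx), inΛY x u → inΛY x v →
          (𝔡₂ x).form U (Pi.single v E) (Pi.single u a) z ≠ 0 → S z) →
        (∀ (u v : IBondY x.toKIdx) (E a : Matrix (Fin N) (Fin N) ℂ), r₂ < unitDistY x u v → (𝔡₂ x).form U (Pi.single v E) (Pi.single u a) = 0) →
        (∀ (u v : IBondY x.toKIdx) (E a : Matrix (Fin N) (Fin N) ℂ), ∑ z, ‖(𝔡₂ x).form U (Pi.single v E) (Pi.single u a) z‖ ≤ C₂ * ‖E‖ * ‖a‖) →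
        (∀ Φ : IBondY x.toKIdx → Matrix (Fin N) (Fin N) ℂ, (∀ u, u ∉ Set.range ι → Φ u = 0) →
          γ₀ * trIP (fun _ => (1 : ℝ)) Φ Φ ≤ trIP (fun _ => (1 : ℝ)) Φ ((CsDeltaCPY x (lettersYOfRecordV4 N θ Mstar (resYOfC2 N θ Mstar 𝔠) x)
            (sectEYOfRecordV6 N θ Mstar (sectEYWithDt2 N θ Mstar (resYOfC2 N θ Mstar 𝔠) 𝔡₂ 𝔢₀) x) U) Φ)) →
      ∃ (Λ : Finset (B1Eq324BenfattoLemma.Site (θ.d₆ + 1 + (θ.d₆ + 1) + 1))) (e' : σ × TrIdx N ≃ ↥Λ),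
        ((gaussianFieldOfKernel fun u w => if h : u ∈ Λ ∧ w ∈ Λ then
            ((Matrix.reindex e' e'
              (Matrix.of fun p q : σ × TrIdx N =>
                  trReForm (trBasis N p.2) (((CsDeltaCPY x (lettersYOfRecordV4 N θ Mstar (resYOfC2 N θ Mstar 𝔠) x)
            (sectEYOfRecordV6 N θ Mstar (sectEYWithDt2 N θ Mstar (resYOfC2 N θ Mstar 𝔠) 𝔡₂ 𝔢₀) x) U).restrictScalars ℝ)
                    (Pi.single (ι q.1) (trBasis N q.2)) (ι p.1))))⁻¹ :
                Matrix ↥Λ ↥Λ ℝ) ⟨u, h.1⟩ ⟨w, h.2⟩ else 0).map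
            (fun (z : B1Eq324BenfattoLemma.Site (θ.d₆ + 1 + (θ.d₆ + 1) + 1) → ℝ) (q : σ × TrIdx N) => z ((e' q : ↥Λ) : B1Eq324BenfattoLemma.Site (θ.d₆ + 1 + (θ.d₆ + 1) + 1))) =
          gaussianFieldOfKernel fun p q =>
            ((Matrix.of fun p q : σ × TrIdx N =>
                trReForm (trBasis N p.2) (((CsDeltaCPY x (lettersYOfRecordV4 N θ Mstar (resYOfC2 N θ Mstar 𝔠) x)
            (sectEYOfRecordV6 N θ Mstar (sectEYWithDt2 N θ Mstar (resYOfC2 N θ Mstar 𝔠) 𝔡₂ 𝔢₀) x) U).restrictScalars ℝ)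
                  (Pi.single (ι q.1) (trBasis N q.2)) (ι p.1)))⁻¹ :
              Matrix (σ × TrIdx N) (σ × TrIdx N) ℝ) p q) ∧
        (∀ p : ℝ, 0 ≤ p →
          ((fun (z : B1Eq324BenfattoLemma.Site (θ.d₆ + 1 + (θ.d₆ + 1) + 1) → ℝ) (q : σ × TrIdx N) => z ((e' q : ↥Λ) : B1Eq324BenfattoLemma.Site (θ.d₆ + 1 + (θ.d₆ + 1) + 1))) ⁻¹'
              {ω : σ × TrIdx N → ℝ | ∀ q, |ω q| ≤ p}) =ᵐ[gaussianFieldOfKernel fun u w => if h : u ∈ Λ ∧ w ∈ Λ then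
                ((Matrix.reindex e' e'
                  (Matrix.of fun p q : σ × TrIdx N =>
                      trReForm (trBasis N p.2) (((CsDeltaCPY x (lettersYOfRecordV4 N θ Mstar (resYOfC2 N θ Mstar 𝔠) x)
            (sectEYOfRecordV6 N θ Mstar (sectEYWithDt2 N θ Mstar (resYOfC2 N θ Mstar 𝔠) 𝔡₂ 𝔢₀) x) U).restrictScalars ℝ)
                        (Pi.single (ι q.1) (trBasis N q.2)) (ι p.1))))⁻¹ :
                    Matrix ↥Λ ↥Λ ℝ) ⟨u, h.1⟩ ⟨w, h.2⟩ else 0]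
            smallFieldSet Λ p) ∧
        ∀ (s : ℕ) (I J : Finset (B1Eq324BenfattoLemma.Site (θ.d₆ + 1 + (θ.d₆ + 1) + 1))) (𝔞 : Coef (θ.d₆ + 1 + (θ.d₆ + 1) + 1)),
          I.Nonempty → J ⊆ I → J ⊆ Λ → coefSup s D 𝔞 J ≤ c * η ^ σ' →
          0 < ∫ z, cutoffBoltzmann (hamiltonian s D ϰ 𝔞 J) I (B10.pFun b₀ p₀ η) z ∂(gaussianFieldOfKernel fun u w => if h : u ∈ Λ ∧ w ∈ Λ then
              ((Matrix.reindex e' e'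
                (Matrix.of fun p q : σ × TrIdx N =>
                    trReForm (trBasis N p.2) (((CsDeltaCPY x (lettersYOfRecordV4 N θ Mstar (resYOfC2 N θ Mstar 𝔠) x)
            (sectEYOfRecordV6 N θ Mstar (sectEYWithDt2 N θ Mstar (resYOfC2 N θ Mstar 𝔠) 𝔡₂ 𝔢₀) x) U).restrictScalars ℝ)
                      (Pi.single (ι q.1) (trBasis N q.2)) (ι p.1))))⁻¹ :
                  Matrix ↥Λ ↥Λ ℝ) ⟨u, h.1⟩ ⟨w, h.2⟩ else 0) ∧
            |Real.log (∫ z, cutoffBoltzmann (hamiltonian s D ϰ 𝔞 J) I (B10.pFun b₀ p₀ η) z ∂(gaussianFieldOfKernel fun u w =>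
                if h : u ∈ Λ ∧ w ∈ Λ then
                  ((Matrix.reindex e' e'
                    (Matrix.of fun p q : σ × TrIdx N =>
                        trReForm (trBasis N p.2) (((CsDeltaCPY x (lettersYOfRecordV4 N θ Mstar (resYOfC2 N θ Mstar 𝔠) x)
            (sectEYOfRecordV6 N θ Mstar (sectEYWithDt2 N θ Mstar (resYOfC2 N θ Mstar 𝔠) 𝔡₂ 𝔢₀) x) U).restrictScalars ℝ)
                          (Pi.single (ι q.1) (trBasis N q.2)) (ι p.1))))⁻¹ :
                      Matrix ↥Λ ↥Λ ℝ) ⟨u, h.1⟩ ⟨w, h.2⟩ else 0)) -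
              cumulantSum (gaussianFieldOfKernel fun u w => if h : u ∈ Λ ∧ w ∈ Λ then
                  ((Matrix.reindex e' e'
                    (Matrix.of fun p q : σ × TrIdx N =>
                        trReForm (trBasis N p.2) (((CsDeltaCPY x (lettersYOfRecordV4 N θ Mstar (resYOfC2 N θ Mstar 𝔠) x)
            (sectEYOfRecordV6 N θ Mstar (sectEYWithDt2 N θ Mstar (resYOfC2 N θ Mstar 𝔠) 𝔡₂ 𝔢₀) x) U).restrictScalars ℝ)
                          (Pi.single (ι q.1) (trBasis N q.2)) (ι p.1))))⁻¹ :
                      Matrix ↥Λ ↥Λ ℝ) ⟨u, h.1⟩ ⟨w, h.2⟩ else 0)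
                (hamiltonian s D ϰ 𝔞 J) t| ≤ C * η ^ κ' * I.card := by
  obtain ⟨M₄, δ, a₀, BP, hM₄, hδ, ha₀, hBP, H⟩ := h26
  obtain ⟨b₁, hb₁⟩ := eq324_CsDeltaCPY_opsYOfRecordV8E_trBasis_of_ineq3132_of_adjCurrent_onΛ_on_unit N θ hD Mstar 𝔠 𝔡₂ 𝔢₀ 𝔢 𝔴 𝔈 (r₂ := r₂)
    hγ₀ hBP.le hδ ha hj₁ hC₂ hsmall t D hϰ hp₀ hσ hc hκ hκσ
  refine ⟨M₄, δ, a₀, hM₄, hδ, ha₀, b₁, fun b₀ hb₀ => ?_⟩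
  obtain ⟨C, hC, hE⟩ := hb₁ b₀ hb₀
  refine ⟨C, hC, ?_⟩
  intro η hη hηle x _ hMx α₀ hα₀ hMa U h1 h2 hP hCr hDr σ _ _ _ ι hι hιT S hHJ hDsupp hDloc hDsz hco
  exact hE η hη hηle x specialUnitaryUnits_le_unitaryUnits U
    (mem_of_reg335R (R₂ := R₂) hR x (U := U) h1) hP hCr hDr ι hι hιT
    (H x hMx α₀ hα₀ hMa U h1 h2).2 S hHJ hDsupp hDloc hDsz hco

end ClassParametric

end Literature.MathematicalPhysics.QuantumFieldTheory.Balaban1983to89.B1Eq324BenfattoClassSectEMemberPrecisionDoorRowsByName
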